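import Literature.Combinatorics.Optimization.ShellLawLevelStep
import Literature.Probability.Moments.HoeffdingCountingRange
import Literature.Computability.AlgebraicComplexity.MultinomialEntropy
import Literature.Computability.AlgebraicComplexity.MultinomialWords
import HarnessLib

/-!
# A sub-Gaussian tail for vertex-additive cut statistics under the shell measure
# (Hoeffding's inequality transferred to `Shell_S(t,c)` by the method of types)

Topic `Literature/Combinatorics/Optimization`; continuation of `ShellLawLevelStep.lean` (shells
`Shell_S(t,c) = {U ⊆ S : |U| = t, |half(U)| = c}` inside a `π`-stable ground set `S` for a fixed-point-free
involution `π` — a perfect matching —, the shell LAW `law_S(t,c;x)` of the block statistic `|U ∩ H|`).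
For a vertex weight `φ : Fin n → ℝ` and the statistic `X_φ(U) = Σ_{v ∈ U} φ(v)` (so `X_{1_H}(U) = |U ∩ H|`,
and `θ₁|U ∩ H₁| + θ₂|U ∩ H₂|` is `X_φ` for `φ = θ₁ 1_{H₁} + θ₂ 1_{H₂}`), this file PROVES, with NO side
conditions on `t, c, S, H` (empty shells and degenerate weights are trivial cases):

* §6 **`card_shellIn_filter_dev_le`** (counting form): with `N = #edges of S`, `t = c + 2s`,
  `μ_φ = (t/|S|)·Σ_{v∈S} φ(v)` (the mean of `X_φ` under the uniform measure on `Shell_S(t,c)`) and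
  `R_φ = Σ_{edges {e,πe} ⊆ S} (|φ e| + |φ (π e)|)²`,
  `#{U ∈ Shell_S(c+2s,c) : |X_φ(U) − μ_φ| ≥ ε} ≤ 2(N+1)³·exp(−2ε²/R_φ)·#Shell_S(c+2s,c)` (`ε ≥ 0`);
* §6 **`sum_shellLaw_le_of_dev`** (law form, the block statistic): for every `t, c`, every finite
  `X ⊆ {x : |x − t|S∩H|/|S|| ≥ ε}`, `Σ_{x∈X} law_S(t,c;x) ≤ 2(N+1)³·exp(−ε²/|S ∩ H|)`;
* §6 **`sum_shellLaw_univ_le_of_dev`** (ground set all of `Fin n`, `N = n/2`, mean `t|H|/n`):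
  `Σ_{x∈X} law(t,c;x) ≤ 2(n/2+1)³·exp(−ε²/|H|)` for `X ⊆ {x : |x − t|H|/n| ≥ ε}` — the `[TAIL]` input of the
  cell's brick 121 (`Summits/PneNP/PneNP/Theorems/ChebyshevTracialDesignVirtualPositivityCriterion`,
  `shellProfile_newton_eval_zero_ge`: the tail mass `Σ_{x ∈ [0,t]∖B} Σ_{j≤D} law(t,2j+1;x)` outside a window
  `B ⊇ {x : |x − t|H|/n| < ε}` is at most `(D+1)·2(n/2+1)³e^{−ε²/|H|}`);
* §7 the consumers' shapes: **`card_shellIn_filter_dev_inter_le`** (the block statistic, counting form, general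
  `S`), **`card_shellIn_filter_dev_two_blocks_le`** (union bound for two blocks `H₁, H₂`), and
  **`sum_sdiff_sum_levels_shellLaw_le`** — literally the `[TAIL]` term of brick 121:
  `Σ_{x ∈ s∖B} Σ_{j ≤ D} law(t,2j+1;x) ≤ (D+1)·2(n/2+1)³·exp(−ε²/|H|)` whenever `|x − t|H|/n| ≥ ε` on `s ∖ B`;
* §8 EDGE-ADDITIVE statistics `Ψ(U) = Σ_{e ∈ reps S} ψ_e(U ∩ {e,πe})` for an arbitrary kernel on the four traces
  (**`card_shellIn_filter_edgeStat_dev_le`**, mean `edgeMean`, Hoeffding form `card_dev_cfg_kernel_le`, fibre count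
  `card_filter_cutOf_mem_eq`): the same bound `2(N+1)³·exp(−2ε²/Σ_e(b_e−a_e)²)·#Shell` for kernels with
  `ψ_e ∈ [a_e,b_e]`; the mixing variables of the half-set decomposition are of this form
  (`card_half_inter_eq_sum_kernel`: `|half(U) ∩ H|`; `card_fullHH_eq_sum_kernel`: the number of full `HH` edges).

METHOD (the three-category analogue of the passage `G(n,p) | {m edges} ≡ G(n,m)` with the count of the
conditioning event bounded below — Frieze–Karoński Lemma 1.1 / Lemma 1.2 —, run on Hoeffding's product
inequality and the method of types, all three already in the tree):
* §2 ENCODING. Label every edge `{e, πe}` of `S` (`e ∈ reps S`, `N` of them) independently and uniformly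
  by `(ℓ_e, β_e) ∈ Fin N × Bool` and read off a cut `U(ω) = ⋃_e piece_e(ω_e)`: the edge is HALF in `U`
  (endpoint `e` if `β_e`, else `πe`) when `ℓ_e < c`, FULL when `c ≤ ℓ_e < c+s`, untouched otherwise
  (`piece`, `cutOf`). Then `X_φ(U(ω)) = Σ_e g_e(ω_e)` is a sum of INDEPENDENT terms with ranges
  `|φ e| + |φ πe|` (`sum_cutOf`), `|U(ω)| = #{ℓ_e < c} + 2#{c ≤ ℓ_e < c+s}`, `|half U(ω)| = #{ℓ_e < c}`
  (`card_cutOf_eq`, `card_half_cutOf`), so `U(ω) ∈ Shell_S(c+2s,c)` as soon as the label word has type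
  `(c, s, N−c−s)` (`cutOf_mem_shellIn`).
* §3 FIBRES. Over every `U ∈ Shell_S(c+2s,c)` the fibre `{ω : U(ω) = U}` is a box with exactly
  `K = c^c·(2s)^s·(2(N−c−s))^{N−c−s}` points (`card_fibre_eq`): a half edge of `U` is hit by `c·1` labels,
  a full edge by `s·2`, an untouched one by `(N−c−s)·2`, and `U` has `c` half, `s` full edges
  (`localType_counts`). Hence uniform-on-the-shell probabilities are ratios of product-space counts.
* §4 TYPES. The words of type `k = (c,s,N−c−s)` over the alphabet `Fin 3` number `binom(N; k)` (the tree's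
  `card_words_eq_multinomial`, transported to any index type: `card_typewords`), each is hit by
  `2^N ∏ₐ kₐ^{kₐ}` label vectors (`card_typeCfg`), and `N^N ≤ (N+1)³·binom(N;k)·∏ₐ kₐ^{kₐ}` is the tree's
  `one_le_card_pow_mul_typeClassMass_self` (Cover–Thomas Thm 11.1.4: the type class of the sampling
  distribution is the likeliest); so `#{ω : U(ω) ∈ Shell} ≥ (2N)^N/(N+1)³` (`typeCfg_lower`).
* §5 HOEFFDING. `#{ω : |Σ_e (g_e(ω_e) − E g_e)| ≥ ε} ≤ 2exp(−2ε²/R_φ)(2N)^N` is the tree's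
  `hoeffding_count_pi_Icc_abs` (Hoeffding 1963 Thm 2 in counting form); `Σ_e E g_e = μ_φ` (`sum_mean_eq`).
* §6 ASSEMBLY: `#A·K ≤ #{dev} ≤ 2e^{−2ε²/R}(2N)^N ≤ 2e^{−2ε²/R}(N+1)³·#Shell·K`.

HONEST LIMITS. (i) The factor `(N+1)³` and the variance proxy `R_φ` (of the order of the number of edges
of `S`, not of the sample size `t`) are artefacts of the transfer. For ONE-stage sampling without
replacement Hoeffding's Theorem 4 [Hoeffding1963, Thm. 4] = [FriezeKaronski2016, Lemma 21.11
(`E f(W_n) ≤ E f(S_n)` for convex `f`, PDF pp. 287–288)] removes both; it is NOT proved here and does not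
by itself cover the two-stage (half/full) shell measure. For the cell's use (`ε = K√(nD)`,
`D = ⌊n^{1/4}⌋`) the polynomial factor is absorbed since `3 log N = o(D)`. (ii) Nothing here is specific
to the crux `TracialDecayExp20` (OPEN); no statement on psd rank or P vs NP. All PROVED, 0 sorry, no
named facts; the definitions (`labelCat`, `piece`, `cutOf`, `repOf`, `edgeMean`) are bookkeeping for the encoding.
Cell pnp-psdrank (lit g34; prover MEMO-25 §4 route B «Hoeffding for the shell measure», brick 121's named
`[TAIL]` input).

## References

* [Hoeffding1963] W. Hoeffding, *Probability inequalities for sums of bounded random variables*,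
  J. Amer. Statist. Assoc. 58 (1963) 13–30: Theorem 2 (independent bounded summands; used through the
  tree's `Literature.Probability.Moments.hoeffding_count_pi_Icc_abs`), Theorem 4 (sampling without
  replacement; the sharper route not taken).
* [FriezeKaronski2016] A. Frieze, M. Karoński, *Introduction to Random Graphs*, CUP 2016 (held
  `book:friezend-introduction-random-graphs`): §1.1 Lemma 1.1 (the product model conditioned on its edge
  count is the uniform model, PDF p. 10), Lemma 1.2 (`P(G_{n,m} ∈ 𝒫) ≤ 10 m^{1/2} P(G_{n,p} ∈ 𝒫)`,
  PDF pp. 11–12) — the transfer principle, here with three categories; §21.5 Lemma 21.11 (PDF pp. 287–288).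
* [CoverThomas2005] T. M. Cover, J. A. Thomas, *Elements of Information Theory*, 2nd ed., Thm. 11.1.4
  (`P^N(T(P)) ≥ (N+1)^{-|𝒳|}`; used through the tree's
  `Literature.Computability.AlgebraicComplexity.one_le_card_pow_mul_typeClassMass_self`).
* [DevroyeGyorfiLugosi1996] L. Devroye, L. Györfi, G. Lugosi, *A Probabilistic Theory of Pattern
  Recognition*, §8.2 Thm 8.1 (the form of Hoeffding's inequality the tree's counting lemma follows).
* [Rothvoss2017] T. Rothvoß, J. ACM 64 (2017), §2 (PDF pp. 5–6): cuts, the partition of a cut by a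
  perfect matching into half and full edges, the level classes.
* [GodsilMeagher2015] C. Godsil, K. Meagher, *Erdős–Ko–Rado Theorems: Algebraic Approaches*, §15.2
  (perfect matchings as fixed-point-free involutions; edge representatives).
-/

noncomputable section

open Finset

namespace Literature.Combinatorics.Optimization

namespace ShellStep

variable {n : ℕ} {π : Fin n → Fin n}

/-! ### §1 The edges of a `π`-stable ground set partition it -/

/-- The representative (smaller endpoint) of the edge `{w, π w}` (plumbing def).
[cite: GodsilMeagher2015, §15.2] -/
def repOf (π : Fin n → Fin n) (w : Fin n) : Fin n := if w < π w then w else π w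

section Edges

variable (hπ : ∀ v, π (π v) = v) (hπ' : ∀ v, π v ≠ v)
include hπ hπ'

omit hπ' in
/-- Distinct representatives have disjoint edges. [cite: GodsilMeagher2015, §15.2] -/
theorem disjoint_pair_of_ne {e e' : Fin n} (he : e < π e) (he' : e' < π e') (hne : e ≠ e') :
    Disjoint ({e, π e} : Finset (Fin n)) {e', π e'} := by
  rw [disjoint_left]
  intro w hw hw'
  simp only [mem_insert, mem_singleton] at hw hw'
  rcases hw with rfl | rfl <;> rcases hw' with h | h
  · exact hne h
  · have h2 : π w = e' := by rw [h, hπ]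
    rw [← h2, hπ] at he'
    exact lt_asymm he he'
  · rw [← h, hπ] at he'
    exact lt_asymm he he'
  · exact hne (π_injective hπ h)

/-- The representative of the edge at a vertex of a `π`-stable set is a representative of that set.
[cite: GodsilMeagher2015, §15.2] -/
theorem repOf_mem_reps {S : Finset (Fin n)} (hS : ∀ v ∈ S, π v ∈ S) {w : Fin n} (hw : w ∈ S) :
    repOf π w ∈ reps π S := by
  unfold repOf
  split_ifs with h
  · exact mem_reps.2 ⟨hw, h⟩
  · refine mem_reps.2 ⟨hS w hw, ?_⟩
    rw [hπ]
    exact lt_of_le_of_ne (not_lt.1 h) (hπ' w)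

omit hπ' in
/-- Every vertex lies on the edge of its representative. [cite: GodsilMeagher2015, §15.2] -/
theorem mem_pair_repOf (w : Fin n) : w ∈ ({repOf π w, π (repOf π w)} : Finset (Fin n)) := by
  unfold repOf
  split_ifs
  · simp
  · simp [hπ]

omit hπ' in
/-- An edge is closed under the partner map. [cite: GodsilMeagher2015, §15.2] -/
theorem partner_mem_pair {e w : Fin n} (hw : w ∈ ({e, π e} : Finset (Fin n))) :
    π w ∈ ({e, π e} : Finset (Fin n)) := by
  simp only [mem_insert, mem_singleton] at hw ⊢
  rcases hw with rfl | rfl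
  · exact Or.inr rfl
  · exact Or.inl (hπ e)

/-- **A `π`-stable set is the disjoint union of its edges**: `Σ_{w ∈ S} F(w) = Σ_{e ∈ reps S} (F e + F(π e))`.
[cite: GodsilMeagher2015, §15.2] -/
theorem sum_eq_sum_reps {M : Type*} [AddCommMonoid M] {S : Finset (Fin n)} (hS : ∀ v ∈ S, π v ∈ S)
    (F : Fin n → M) : ∑ w ∈ S, F w = ∑ e ∈ reps π S, (F e + F (π e)) := by
  have hR : ∀ v ∈ reps π S, v < π v := fun v hv => (mem_reps.1 hv).2
  have hdisj : Disjoint (reps π S) ((reps π S).image π) := by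
    rw [disjoint_left]
    intro v hv hv'
    obtain ⟨w, hw, hwv⟩ := mem_image.1 hv'
    have h1 := hR v hv
    have h2 := hR w hw
    rw [← hwv, hπ] at h1
    exact lt_asymm h1 h2
  calc ∑ w ∈ S, F w = ∑ w ∈ close π (reps π S), F w := by rw [close_reps hπ hπ' hS]
    _ = ∑ w ∈ reps π S, F w + ∑ w ∈ (reps π S).image π, F w := by
        rw [close, sum_union hdisj]
    _ = ∑ w ∈ reps π S, F w + ∑ w ∈ reps π S, F (π w) := by
        rw [sum_image fun a _ b _ h => π_injective hπ h]
    _ = ∑ e ∈ reps π S, (F e + F (π e)) := by rw [sum_add_distrib]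

omit hπ hπ' in
/-- The trace of a set on an edge: `|W ∩ {a, b}| = [a ∈ W] + [b ∈ W]` for `a ≠ b`. [folklore] -/
private theorem card_inter_pair {W : Finset (Fin n)} {a b : Fin n} (h : a ≠ b) :
    (W ∩ {a, b}).card = (if a ∈ W then 1 else 0) + (if b ∈ W then 1 else 0) := by
  have hab : W ∩ {a, b} = ({a, b} : Finset (Fin n)).filter (· ∈ W) := by
    rw [filter_mem_eq_inter, inter_comm]
  rw [hab, filter_insert, filter_singleton]
  by_cases ha : a ∈ W <;> by_cases hb : b ∈ W
  · simp only [ha, hb, if_true]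
    exact card_pair h
  · simp [ha, hb]
  · simp [ha, hb]
  · simp [ha, hb]

/-- **Cardinality edge by edge**: for `W ⊆ S`, `|W| = Σ_{e ∈ reps S} |W ∩ {e, πe}|`.
[cite: GodsilMeagher2015, §15.2] -/
theorem card_eq_sum_card_inter_pair {S : Finset (Fin n)} (hS : ∀ v ∈ S, π v ∈ S) {W : Finset (Fin n)}
    (hW : W ⊆ S) : W.card = ∑ e ∈ reps π S, (W ∩ {e, π e}).card := by
  have h1 : W.card = ∑ w ∈ S, if w ∈ W then 1 else 0 := by
    rw [sum_boole, Nat.cast_id, filter_mem_eq_inter, inter_eq_right.2 hW]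
  rw [h1, sum_eq_sum_reps hπ hπ' hS]
  refine sum_congr rfl fun e _ => ?_
  rw [card_inter_pair (show e ≠ π e from fun h => hπ' e h.symm)]

end Edges

/-! ### §2 The encoding of cuts by independent edge labels -/

/-- The category of a label `ℓ ∈ Fin N` for the thresholds `c, s`: `0` (half edge) if `ℓ < c`, `1` (full
edge) if `c ≤ ℓ < c + s`, `2` (untouched edge) otherwise (plumbing def).
[cite: FriezeKaronski2016, §1.1 Lemma 1.1 (PDF p. 10)] -/
def labelCat (c s : ℕ) {N : ℕ} (ℓ : Fin N) : Fin 3 :=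
  if (ℓ : ℕ) < c then 0 else if (ℓ : ℕ) < c + s then 1 else 2

/-- The piece of the encoded cut on the edge `{v, π v}` prescribed by a label and an orientation bit: the
endpoint `v` (bit `true`) or `π v` (bit `false`) of a half edge, both endpoints of a full edge, nothing on
an untouched edge (plumbing def). [cite: Rothvoss2017, §2 (PDF p. 5)] -/
def piece (π : Fin n → Fin n) (c s : ℕ) {N : ℕ} (v : Fin n) (lb : Fin N × Bool) : Finset (Fin n) :=
  if (lb.1 : ℕ) < c then {if lb.2 then v else π v}
  else if (lb.1 : ℕ) < c + s then {v, π v} else ∅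

/-- The cut encoded by a label vector `ω` on the edges of `S` (indexed by their representatives): the union
of its pieces (plumbing def). [cite: Rothvoss2017, §2 (PDF p. 5)] -/
def cutOf (π : Fin n → Fin n) (S : Finset (Fin n)) (c s : ℕ)
    (ω : reps π S → Fin (reps π S).card × Bool) : Finset (Fin n) :=
  univ.biUnion fun e : reps π S => piece π c s (e : Fin n) (ω e)

/-- `labelCat ℓ = 0 ↔ ℓ < c`. [folklore] -/
private theorem labelCat_eq_zero_iff {c s N : ℕ} (ℓ : Fin N) : labelCat c s ℓ = 0 ↔ (ℓ : ℕ) < c := by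
  unfold labelCat
  split_ifs with h1 h2
  · simp [h1]
  · simp only [h1, iff_false]; decide
  · simp only [h1, iff_false]; decide

/-- `labelCat ℓ = 1 ↔ c ≤ ℓ < c + s`. [folklore] -/
private theorem labelCat_eq_one_iff {c s N : ℕ} (ℓ : Fin N) :
    labelCat c s ℓ = 1 ↔ ¬ (ℓ : ℕ) < c ∧ (ℓ : ℕ) < c + s := by
  unfold labelCat
  split_ifs with h1 h2
  · simp only [h1, not_true_eq_false, false_and, iff_false]; decide
  · simp [h1, h2]
  · simp only [h1, h2, not_false_eq_true, and_false, iff_false]; decide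

/-- `labelCat ℓ = 2 ↔ c + s ≤ ℓ`. [folklore] -/
private theorem labelCat_eq_two_iff {c s N : ℕ} (ℓ : Fin N) : labelCat c s ℓ = 2 ↔ ¬ (ℓ : ℕ) < c + s := by
  unfold labelCat
  split_ifs with h1 h2
  · have : (ℓ : ℕ) < c + s := by omega
    simp only [this, not_true_eq_false, iff_false]; decide
  · simp only [h2, not_true_eq_false, iff_false]; decide
  · simp [h2]

/-- A piece lies on its edge. [cite: Rothvoss2017, §2 (PDF p. 5)] -/
theorem piece_subset_pair (c s : ℕ) {N : ℕ} (v : Fin n) (lb : Fin N × Bool) :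
    piece π c s v lb ⊆ {v, π v} := by
  unfold piece
  split_ifs <;> simp [subset_iff]

/-- The size of a piece: `1` on a half edge, `2` on a full edge, `0` otherwise. [cite: Rothvoss2017, §2 (PDF p. 5)] -/
theorem card_piece (hπ' : ∀ v, π v ≠ v) (c s : ℕ) {N : ℕ} (v : Fin n) (lb : Fin N × Bool) :
    (piece π c s v lb).card = if (lb.1 : ℕ) < c then 1 else if (lb.1 : ℕ) < c + s then 2 else 0 := by
  unfold piece
  split_ifs <;> simp [card_pair (hπ' v).symm]

/-- A piece equals the endpoint `{v}` iff the edge is half with bit `true`. [cite: Rothvoss2017, §2 (PDF p. 5)] -/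
theorem piece_eq_singleton_iff (hπ' : ∀ v, π v ≠ v) (c s : ℕ) {N : ℕ} (v : Fin n) (ℓ : Fin N) (b : Bool) :
    piece π c s v (ℓ, b) = {v} ↔ (ℓ : ℕ) < c ∧ b = true := by
  have hne : π v ≠ v := hπ' v
  have hpair : ({v, π v} : Finset (Fin n)) ≠ {v} := fun h => by
    have := congrArg Finset.card h
    rw [card_pair hne.symm, card_singleton] at this
    omega
  simp only [piece]
  split_ifs with h1 hb h2 <;> simp_all [singleton_inj, (singleton_ne_empty v).symm]

/-- A piece equals the endpoint `{π v}` iff the edge is half with bit `false`. [cite: Rothvoss2017, §2 (PDF p. 5)] -/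
theorem piece_eq_singleton_partner_iff (hπ' : ∀ v, π v ≠ v) (c s : ℕ) {N : ℕ} (v : Fin n) (ℓ : Fin N)
    (b : Bool) : piece π c s v (ℓ, b) = {π v} ↔ (ℓ : ℕ) < c ∧ b = false := by
  have hne : π v ≠ v := hπ' v
  have hpair : ({v, π v} : Finset (Fin n)) ≠ {π v} := fun h => by
    have := congrArg Finset.card h
    rw [card_pair hne.symm, card_singleton] at this
    omega
  simp only [piece]
  split_ifs with h1 hb h2 <;> simp_all [singleton_inj, (singleton_ne_empty (π v)).symm]

/-- A piece is the whole edge iff the edge is full. [cite: Rothvoss2017, §2 (PDF p. 5)] -/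
theorem piece_eq_pair_iff (hπ' : ∀ v, π v ≠ v) (c s : ℕ) {N : ℕ} (v : Fin n) (ℓ : Fin N) (b : Bool) :
    piece π c s v (ℓ, b) = {v, π v} ↔ ¬ (ℓ : ℕ) < c ∧ (ℓ : ℕ) < c + s := by
  have hne : π v ≠ v := hπ' v
  have h2' : ({v, π v} : Finset (Fin n)).card = 2 := card_pair hne.symm
  have hsv : ({v} : Finset (Fin n)) ≠ {v, π v} := fun h => by
    have := congrArg Finset.card h; rw [h2', card_singleton] at this; omega
  have hsπ : ({π v} : Finset (Fin n)) ≠ {v, π v} := fun h => by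
    have := congrArg Finset.card h; rw [h2', card_singleton] at this; omega
  have he : (∅ : Finset (Fin n)) ≠ {v, π v} := fun h => by
    have := congrArg Finset.card h; rw [h2', card_empty] at this; omega
  simp only [piece]
  split_ifs with h1 hb h2 <;> simp_all

/-- A piece is empty iff the edge is untouched. [cite: Rothvoss2017, §2 (PDF p. 5)] -/
theorem piece_eq_empty_iff (c s : ℕ) {N : ℕ} (v : Fin n) (ℓ : Fin N) (b : Bool) :
    piece π c s v (ℓ, b) = ∅ ↔ ¬ (ℓ : ℕ) < c + s := by
  simp only [piece]
  split_ifs with h1 hb h2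
  · simp only [singleton_ne_empty, false_iff, not_not]; omega
  · simp only [singleton_ne_empty, false_iff, not_not]; omega
  · simp only [insert_ne_empty, h2, not_true_eq_false]
  · simp [h2]

section Encoding

variable (hπ : ∀ v, π (π v) = v) (hπ' : ∀ v, π v ≠ v)
include hπ hπ'

omit hπ' in
/-- The pieces of an encoded cut are pairwise disjoint (they lie on distinct edges).
[cite: Rothvoss2017, §2 (PDF p. 5)] -/
theorem pairwiseDisjoint_piece {S : Finset (Fin n)} (c s : ℕ) (ω : reps π S → Fin (reps π S).card × Bool) :
    ((univ : Finset (reps π S)) : Set (reps π S)).PairwiseDisjoint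
      fun e => piece π c s (e : Fin n) (ω e) := by
  intro e _ e' _ hne
  have he := (mem_reps.1 e.2).2
  have he' := (mem_reps.1 e'.2).2
  have hne' : (e : Fin n) ≠ e' := fun h => hne (Subtype.ext h)
  exact (disjoint_pair_of_ne hπ he he' hne').mono (piece_subset_pair _ _ _ _) (piece_subset_pair _ _ _ _)

omit hπ' in
/-- The trace of the encoded cut on an edge is the piece on that edge. [cite: Rothvoss2017, §2 (PDF p. 5)] -/
theorem cutOf_inter_pair {S : Finset (Fin n)} (c s : ℕ) (ω : reps π S → Fin (reps π S).card × Bool)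
    (e : reps π S) : cutOf π S c s ω ∩ {(e : Fin n), π e} = piece π c s (e : Fin n) (ω e) := by
  ext w
  simp only [cutOf, mem_inter, mem_biUnion, mem_univ, true_and]
  constructor
  · rintro ⟨⟨e', hw⟩, hwe⟩
    by_cases h : e' = e
    · subst h; exact hw
    · exfalso
      have he := (mem_reps.1 e.2).2
      have he' := (mem_reps.1 e'.2).2
      have hne' : (e' : Fin n) ≠ e := fun h' => h (Subtype.ext h')
      exact disjoint_left.1 (disjoint_pair_of_ne hπ he' he hne') (piece_subset_pair _ _ _ _ hw) hwe
  · intro hw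
    exact ⟨⟨e, hw⟩, piece_subset_pair _ _ _ _ hw⟩

omit hπ hπ' in
/-- The encoded cut lies in the ground set. [cite: Rothvoss2017, §2 (PDF p. 5)] -/
theorem cutOf_subset {S : Finset (Fin n)} (hS : ∀ v ∈ S, π v ∈ S) (c s : ℕ)
    (ω : reps π S → Fin (reps π S).card × Bool) : cutOf π S c s ω ⊆ S := by
  intro w hw
  simp only [cutOf, mem_biUnion, mem_univ, true_and] at hw
  obtain ⟨e, hw⟩ := hw
  have hwp := piece_subset_pair _ _ _ _ hw
  have heS : (e : Fin n) ∈ S := (mem_reps.1 e.2).1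
  simp only [mem_insert, mem_singleton] at hwp
  rcases hwp with rfl | rfl
  · exact heS
  · exact hS _ heS

/-- **The fibre condition**: `U(ω) = U` iff every piece of `ω` is the trace of `U` on its edge (`U ⊆ S`).
[cite: FriezeKaronski2016, §1.1 Lemma 1.1 (PDF p. 10)] -/
theorem cutOf_eq_iff {S : Finset (Fin n)} (hS : ∀ v ∈ S, π v ∈ S) (c s : ℕ)
    (ω : reps π S → Fin (reps π S).card × Bool) {U : Finset (Fin n)} (hU : U ⊆ S) :
    cutOf π S c s ω = U ↔ ∀ e : reps π S, piece π c s (e : Fin n) (ω e) = U ∩ {(e : Fin n), π e} := by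
  constructor
  · intro h e
    rw [← h, cutOf_inter_pair hπ c s ω e]
  · intro h
    ext w
    constructor
    · intro hw
      simp only [cutOf, mem_biUnion, mem_univ, true_and] at hw
      obtain ⟨e, hwe⟩ := hw
      rw [h e] at hwe
      exact (mem_inter.1 hwe).1
    · intro hwU
      have hr : repOf π w ∈ reps π S := repOf_mem_reps hπ hπ' hS (hU hwU)
      have hwr : w ∈ ({repOf π w, π (repOf π w)} : Finset (Fin n)) := mem_pair_repOf hπ w
      have hw : w ∈ piece π c s (repOf π w) (ω ⟨repOf π w, hr⟩) := by
        rw [h ⟨repOf π w, hr⟩]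
        exact mem_inter.2 ⟨hwU, hwr⟩
      simp only [cutOf, mem_biUnion, mem_univ, true_and]
      exact ⟨⟨repOf π w, hr⟩, hw⟩

omit hπ' in
/-- **Additivity**: a vertex-additive statistic of the encoded cut is the sum of its edge terms,
`Σ_{w ∈ U(ω)} φ(w) = Σ_e Σ_{w ∈ piece_e(ω_e)} φ(w)`. [cite: Hoeffding1963, Thm. 2 (independent summands)] -/
theorem sum_cutOf {S : Finset (Fin n)} (c s : ℕ) (ω : reps π S → Fin (reps π S).card × Bool)
    (φ : Fin n → ℝ) :
    ∑ w ∈ cutOf π S c s ω, φ w = ∑ e : reps π S, ∑ w ∈ piece π c s (e : Fin n) (ω e), φ w := by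
  unfold cutOf
  rw [sum_biUnion (pairwiseDisjoint_piece hπ c s ω)]

/-- The size of the encoded cut: `#half labels + 2·#full labels`. [cite: Rothvoss2017, §2 (PDF p. 5)] -/
theorem card_cutOf_eq {S : Finset (Fin n)} (c s : ℕ) (ω : reps π S → Fin (reps π S).card × Bool) :
    (cutOf π S c s ω).card = (univ.filter fun e : reps π S => ((ω e).1 : ℕ) < c).card +
      2 * (univ.filter fun e : reps π S => ¬ ((ω e).1 : ℕ) < c ∧ ((ω e).1 : ℕ) < c + s).card := by
  unfold cutOf
  rw [card_biUnion (pairwiseDisjoint_piece hπ c s ω), card_filter, card_filter, mul_sum,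
    ← sum_add_distrib]
  refine sum_congr rfl fun e _ => ?_
  rw [card_piece hπ']
  by_cases h1 : ((ω e).1 : ℕ) < c <;> by_cases h2 : ((ω e).1 : ℕ) < c + s <;> simp [h1, h2]

omit hπ' in
/-- The half-matched vertices on one edge: the trace of `half(U)` on `{e, πe}` consists of the points of
`U ∩ {e, πe}` whose partner is not in `U ∩ {e, πe}`. [cite: Rothvoss2017, §2 (PDF p. 5)] -/
theorem half_inter_pair_eq_filter (U : Finset (Fin n)) (e : Fin n) :
    half π U ∩ {e, π e} = (U ∩ {e, π e}).filter fun w => π w ∉ U ∩ {e, π e} := by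
  ext w
  simp only [mem_inter, mem_half, mem_filter]
  constructor
  · rintro ⟨⟨hwU, hπw⟩, hwp⟩
    exact ⟨⟨hwU, hwp⟩, fun h => hπw h.1⟩
  · rintro ⟨⟨hwU, hwp⟩, h⟩
    exact ⟨⟨hwU, fun hπwU => h ⟨hπwU, partner_mem_pair hπ hwp⟩⟩, hwp⟩

/-- **Half edges are the edges met once**: `|half(U) ∩ {e, πe}| = [|U ∩ {e, πe}| = 1]`.
[cite: Rothvoss2017, §2 (PDF p. 5)] -/
theorem card_half_inter_pair (U : Finset (Fin n)) (e : Fin n) :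
    (half π U ∩ {e, π e}).card = if (U ∩ {e, π e}).card = 1 then 1 else 0 := by
  have hne : e ≠ π e := fun h => hπ' e h.symm
  rw [half_inter_pair_eq_filter hπ U e]
  by_cases he : e ∈ U <;> by_cases hπe : π e ∈ U
  · have hT : U ∩ {e, π e} = {e, π e} :=
      inter_eq_right.2 (insert_subset he (singleton_subset_iff.2 hπe))
    rw [hT, card_pair hne]
    have hempty : (({e, π e} : Finset (Fin n)).filter fun w => π w ∉ ({e, π e} : Finset (Fin n))) = ∅ := by
      refine filter_false_of_mem fun w hw => ?_
      exact not_not.2 (partner_mem_pair hπ hw)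
    rw [hempty]; simp
  · have hT : U ∩ {e, π e} = {e} := by
      ext w; simp only [mem_inter, mem_insert, mem_singleton]
      constructor
      · rintro ⟨hw, rfl | rfl⟩
        · rfl
        · exact absurd hw hπe
      · rintro rfl; exact ⟨he, Or.inl rfl⟩
    rw [hT, card_singleton, filter_singleton]
    simp [hne.symm]
  · have hT : U ∩ {e, π e} = {π e} := by
      ext w; simp only [mem_inter, mem_insert, mem_singleton]
      constructor
      · rintro ⟨hw, rfl | rfl⟩
        · exact absurd hw he
        · rfl
      · rintro rfl; exact ⟨hπe, Or.inr rfl⟩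
    rw [hT, card_singleton, filter_singleton]
    simp [hπ, hne]
  · have hT : U ∩ {e, π e} = ∅ := by
      ext w; simp only [mem_inter, mem_insert, mem_singleton, notMem_empty, iff_false]
      rintro ⟨hw, rfl | rfl⟩
      · exact he hw
      · exact hπe hw
    rw [hT]; simp

/-- The number of half-matched vertices of the encoded cut: `#half labels`. [cite: Rothvoss2017, §2 (PDF p. 5)] -/
theorem card_half_cutOf {S : Finset (Fin n)} (hS : ∀ v ∈ S, π v ∈ S) (c s : ℕ)
    (ω : reps π S → Fin (reps π S).card × Bool) :
    (half π (cutOf π S c s ω)).card = (univ.filter fun e : reps π S => ((ω e).1 : ℕ) < c).card := by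
  rw [card_eq_sum_card_inter_pair hπ hπ' hS ((half_subset _).trans (cutOf_subset hS c s ω)),
    ← sum_coe_sort (reps π S), card_filter]
  refine sum_congr rfl fun e _ => ?_
  rw [card_half_inter_pair hπ hπ', cutOf_inter_pair hπ c s ω e, card_piece hπ']
  by_cases h1 : ((ω e).1 : ℕ) < c <;> by_cases h2 : ((ω e).1 : ℕ) < c + s <;> simp [h1, h2]

/-- **The encoded cut is in the shell** as soon as the label word has `c` half and `s` full labels.
[cite: FriezeKaronski2016, §1.1 Lemma 1.1 (PDF p. 10)] -/
theorem cutOf_mem_shellIn {S : Finset (Fin n)} (hS : ∀ v ∈ S, π v ∈ S) {c s : ℕ}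
    (ω : reps π S → Fin (reps π S).card × Bool)
    (h0 : (univ.filter fun e : reps π S => ((ω e).1 : ℕ) < c).card = c)
    (h1 : (univ.filter fun e : reps π S => ¬ ((ω e).1 : ℕ) < c ∧ ((ω e).1 : ℕ) < c + s).card = s) :
    cutOf π S c s ω ∈ shellIn π S (c + 2 * s) c := by
  rw [mem_shellIn]
  refine ⟨cutOf_subset hS c s ω, ?_, ?_⟩
  · rw [card_cutOf_eq hπ hπ', h0, h1]
  · rw [card_half_cutOf hπ hπ' hS, h0]

end Encoding

/-! ### §3 The fibres of the encoding over the shell all have the same size -/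

/-- Counting over `α × Bool` by the two values of the bit. [folklore] -/
private theorem card_filter_prod_bool {α : Type*} [Fintype α] (P : α × Bool → Prop) [DecidablePred P] :
    (univ.filter P).card =
      (univ.filter fun a => P (a, true)).card + (univ.filter fun a => P (a, false)).card := by
  rw [card_filter, card_filter, card_filter, Fintype.sum_prod_type, ← sum_add_distrib]
  refine sum_congr rfl fun a _ => ?_
  rw [Fintype.sum_bool]

/-- `#{ℓ ∈ Fin N : ℓ < c} = c` for `c ≤ N`. [folklore] -/
private theorem card_labels_lt {N : ℕ} (c : ℕ) (hc : c ≤ N) :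
    (univ.filter fun ℓ : Fin N => (ℓ : ℕ) < c).card = c := by
  rw [Fin.card_filter_val_lt, min_eq_right hc]

/-- `#{ℓ ∈ Fin N : c ≤ ℓ < c + s} = s` for `c + s ≤ N`. [folklore] -/
private theorem card_labels_mid {N : ℕ} (c s : ℕ) (hcs : c + s ≤ N) :
    (univ.filter fun ℓ : Fin N => ¬ (ℓ : ℕ) < c ∧ (ℓ : ℕ) < c + s).card = s := by
  have h : (univ.filter fun ℓ : Fin N => ¬ (ℓ : ℕ) < c ∧ (ℓ : ℕ) < c + s) =
      (univ.filter fun ℓ : Fin N => (ℓ : ℕ) < c + s) \ (univ.filter fun ℓ : Fin N => (ℓ : ℕ) < c) := by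
    ext ℓ; simp only [mem_filter, mem_univ, true_and, mem_sdiff]; tauto
  have hsub : (univ.filter fun ℓ : Fin N => (ℓ : ℕ) < c) ⊆ (univ.filter fun ℓ : Fin N => (ℓ : ℕ) < c + s) := by
    intro ℓ; simp only [mem_filter, mem_univ, true_and]; intro h; omega
  rw [h, card_sdiff_of_subset hsub, card_labels_lt _ hcs, card_labels_lt _ ((Nat.le_add_right c s).trans hcs)]
  omega

/-- `#{ℓ ∈ Fin N : c + s ≤ ℓ} = N − (c + s)` for `c + s ≤ N`. [folklore] -/
private theorem card_labels_ge {N : ℕ} (c s : ℕ) (hcs : c + s ≤ N) :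
    (univ.filter fun ℓ : Fin N => ¬ (ℓ : ℕ) < c + s).card = N - (c + s) := by
  rw [filter_not, card_sdiff_of_subset (filter_subset _ _), card_univ, Fintype.card_fin,
    card_labels_lt _ hcs]

/-- The number of labels of each category is the prescribed count `k = (c, s, N − c − s)`.
[cite: CoverThomas2005, Thm. 11.1.4] -/
theorem card_labels_cat {N : ℕ} (c s : ℕ) (hcs : c + s ≤ N) (a : Fin 3) :
    (univ.filter fun ℓ : Fin N => labelCat c s ℓ = a).card = ![c, s, N - (c + s)] a := by
  fin_cases a
  · show (univ.filter fun ℓ : Fin N => labelCat c s ℓ = 0).card = c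
    simp_rw [labelCat_eq_zero_iff]
    exact card_labels_lt c ((Nat.le_add_right c s).trans hcs)
  · show (univ.filter fun ℓ : Fin N => labelCat c s ℓ = 1).card = s
    simp_rw [labelCat_eq_one_iff]
    exact card_labels_mid c s hcs
  · show (univ.filter fun ℓ : Fin N => labelCat c s ℓ = 2).card = N - (c + s)
    simp_rw [labelCat_eq_two_iff]
    exact card_labels_ge c s hcs

/-- **Labels hitting a prescribed trace.** For `T ⊆ {v, πv}` the number of label–bit pairs whose piece is
`T` is `c` if `|T| = 1`, `2s` if `|T| = 2`, `2(N − c − s)` if `T = ∅`. [cite: FriezeKaronski2016, §1.1 Lemma 1.1 (PDF p. 10)] -/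
theorem card_filter_piece_eq (hπ' : ∀ v, π v ≠ v) {N c s : ℕ} (hcs : c + s ≤ N) (v : Fin n)
    (T : Finset (Fin n)) (hT : T ⊆ {v, π v}) :
    (univ.filter fun lb : Fin N × Bool => piece π c s v lb = T).card =
      if T.card = 1 then c else if T.card = 2 then 2 * s else 2 * (N - (c + s)) := by
  have hne : v ≠ π v := fun h => hπ' v h.symm
  have hc : c ≤ N := (Nat.le_add_right c s).trans hcs
  have hfalse : (univ.filter fun _ℓ : Fin N => False).card = 0 := by simp
  by_cases hv : v ∈ T <;> by_cases hπv : π v ∈ T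
  · have hT' : T = {v, π v} := Subset.antisymm hT (insert_subset hv (singleton_subset_iff.2 hπv))
    subst hT'
    rw [card_pair hne, card_filter_prod_bool]
    simp_rw [piece_eq_pair_iff hπ']
    rw [card_labels_mid c s hcs]
    simp
    ring
  · have hT' : T = {v} := by
      refine Subset.antisymm (fun w hw => ?_) (singleton_subset_iff.2 hv)
      have h := hT hw
      simp only [mem_insert, mem_singleton] at h ⊢
      rcases h with rfl | rfl
      · rfl
      · exact absurd hw hπv
    subst hT'
    rw [card_singleton, card_filter_prod_bool]
    simp_rw [piece_eq_singleton_iff hπ']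
    simp only [and_true, Bool.false_eq_true, and_false, if_true]
    rw [card_labels_lt c hc, hfalse, add_zero]
  · have hT' : T = {π v} := by
      refine Subset.antisymm (fun w hw => ?_) (singleton_subset_iff.2 hπv)
      have h := hT hw
      simp only [mem_insert, mem_singleton] at h ⊢
      rcases h with rfl | rfl
      · exact absurd hw hv
      · rfl
    subst hT'
    rw [card_singleton, card_filter_prod_bool]
    simp_rw [piece_eq_singleton_partner_iff hπ']
    simp only [Bool.true_eq_false, and_false, and_true, if_true]
    rw [card_labels_lt c hc, hfalse, zero_add]
  · have hT' : T = ∅ := by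
      ext w; simp only [notMem_empty, iff_false]
      intro hw
      have h := hT hw
      simp only [mem_insert, mem_singleton] at h
      rcases h with rfl | rfl
      · exact hv hw
      · exact hπv hw
    subst hT'
    rw [card_empty, card_filter_prod_bool]
    simp_rw [piece_eq_empty_iff]
    rw [card_labels_ge c s hcs]
    simp
    ring

/-- Regrouping a product by a `{0,1,2}`-valued statistic. [folklore] -/
private theorem prod_eq_pow_three {ι : Type*} (t : Finset ι) (x : ι → ℕ) (hx : ∀ i ∈ t, x i ≤ 2) (F : ℕ → ℕ) :
    ∏ i ∈ t, F (x i) = F 0 ^ (t.filter fun i => x i = 0).card * F 1 ^ (t.filter fun i => x i = 1).card *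
      F 2 ^ (t.filter fun i => x i = 2).card := by
  rw [← prod_fiberwise_of_maps_to (t := range 3) (g := x)
    (fun i hi => mem_range.2 (Nat.lt_succ_of_le (hx i hi)))]
  have h : ∀ j, ∏ i ∈ t with x i = j, F (x i) = F j ^ (t.filter fun i => x i = j).card := by
    intro j
    rw [← prod_const]
    exact prod_congr rfl fun i hi => by rw [(mem_filter.1 hi).2]
  rw [prod_range_succ, prod_range_succ, prod_range_succ, prod_range_zero, one_mul, h 0, h 1, h 2]

/-- Summing a `{0,1,2}`-valued statistic and counting its fibres. [folklore] -/
private theorem sum_eq_card_add_two_mul_card {ι : Type*} (t : Finset ι) (x : ι → ℕ) (hx : ∀ i ∈ t, x i ≤ 2) :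
    ∑ i ∈ t, x i = (t.filter fun i => x i = 1).card + 2 * (t.filter fun i => x i = 2).card ∧
    (t.filter fun i => x i = 0).card + (t.filter fun i => x i = 1).card +
      (t.filter fun i => x i = 2).card = t.card := by
  constructor
  · rw [card_filter, card_filter, mul_sum, ← sum_add_distrib]
    refine sum_congr rfl fun i hi => ?_
    have := hx i hi
    interval_cases (x i) <;> simp
  · rw [card_filter, card_filter, card_filter, ← sum_add_distrib, ← sum_add_distrib, card_eq_sum_ones]
    refine sum_congr rfl fun i hi => ?_
    have := hx i hi
    interval_cases (x i) <;> simp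

section Fibres

variable (hπ : ∀ v, π (π v) = v) (hπ' : ∀ v, π v ≠ v)
include hπ hπ'

/-- **The local types of a shell element**: a cut `U ∈ Shell_S(c+2s, c)` meets exactly `c` edges once
(its half edges), `s` edges twice (its full edges) and misses `N − c − s`; in particular `c + s ≤ N`.
[cite: Rothvoss2017, §2 (PDF pp. 5–6)] -/
theorem localType_counts {S : Finset (Fin n)} (hS : ∀ v ∈ S, π v ∈ S) {c s : ℕ} {U : Finset (Fin n)}
    (hU : U ∈ shellIn π S (c + 2 * s) c) :
    ((reps π S).filter fun e => (U ∩ {e, π e}).card = 1).card = c ∧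
    ((reps π S).filter fun e => (U ∩ {e, π e}).card = 2).card = s ∧
    ((reps π S).filter fun e => (U ∩ {e, π e}).card = 0).card = (reps π S).card - (c + s) ∧
    c + s ≤ (reps π S).card := by
  obtain ⟨hUS, hUc, hUh⟩ := mem_shellIn.1 hU
  have hx : ∀ e ∈ reps π S, (U ∩ {e, π e}).card ≤ 2 := fun e he => by
    have hne : e ≠ π e := fun h => hπ' e h.symm
    exact (card_le_card inter_subset_right).trans (card_pair hne).le
  have hsum : ∑ e ∈ reps π S, (U ∩ {e, π e}).card = c + 2 * s := by
    rw [← card_eq_sum_card_inter_pair hπ hπ' hS hUS, hUc]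
  have hhalf : ((reps π S).filter fun e => (U ∩ {e, π e}).card = 1).card = c := by
    rw [← hUh, card_eq_sum_card_inter_pair hπ hπ' hS ((half_subset U).trans hUS), card_filter]
    exact (sum_congr rfl fun e _ => card_half_inter_pair hπ hπ' U e).symm
  obtain ⟨h1, h2⟩ := sum_eq_card_add_two_mul_card (reps π S) (fun e => (U ∩ {e, π e}).card) hx
  rw [hsum, hhalf] at h1
  rw [hhalf] at h2
  refine ⟨hhalf, by omega, by omega, by omega⟩

/-- The fibre of the encoding over a subset of the ground set is a box.
[cite: FriezeKaronski2016, §1.1 Lemma 1.1 (PDF p. 10)] -/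
theorem filter_cutOf_eq_piFinset {S : Finset (Fin n)} (hS : ∀ v ∈ S, π v ∈ S) (c s : ℕ)
    {U : Finset (Fin n)} (hU : U ⊆ S) :
    (univ.filter fun ω : reps π S → Fin (reps π S).card × Bool => cutOf π S c s ω = U) =
      Fintype.piFinset fun e : reps π S =>
        univ.filter fun lb => piece π c s (e : Fin n) lb = U ∩ {(e : Fin n), π e} := by
  ext ω
  simp only [mem_filter, mem_univ, true_and, Fintype.mem_piFinset]
  exact cutOf_eq_iff hπ hπ' hS c s ω hU

/-- **Equal fibres**: over every `U ∈ Shell_S(c+2s, c)` the encoding has exactly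
`c^c · (2s)^s · (2(N−c−s))^{N−c−s}` preimages. [cite: FriezeKaronski2016, §1.1 Lemma 1.1 (PDF p. 10)] -/
theorem card_fibre_eq {S : Finset (Fin n)} (hS : ∀ v ∈ S, π v ∈ S) {c s : ℕ} {U : Finset (Fin n)}
    (hU : U ∈ shellIn π S (c + 2 * s) c) :
    (univ.filter fun ω : reps π S → Fin (reps π S).card × Bool => cutOf π S c s ω = U).card =
      c ^ c * (2 * s) ^ s *
        (2 * ((reps π S).card - (c + s))) ^ ((reps π S).card - (c + s)) := by
  obtain ⟨h1, h2, h0, hcs⟩ := localType_counts hπ hπ' hS hU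
  have hUS : U ⊆ S := (mem_shellIn.1 hU).1
  set N := (reps π S).card with hN
  rw [filter_cutOf_eq_piFinset hπ hπ' hS c s hUS, Fintype.card_piFinset]
  set F : ℕ → ℕ := fun x => if x = 1 then c else if x = 2 then 2 * s else 2 * (N - (c + s)) with hF
  have hstep : ∀ e : reps π S,
      (univ.filter fun lb : Fin N × Bool => piece π c s (e : Fin n) lb = U ∩ {(e : Fin n), π e}).card =
        F ((U ∩ {(e : Fin n), π e}).card) := fun e =>
    card_filter_piece_eq hπ' hcs _ _ inter_subset_right
  rw [prod_congr rfl fun e _ => hstep e,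
    prod_coe_sort (reps π S) (fun e => F ((U ∩ {e, π e}).card))]
  have hx : ∀ e ∈ reps π S, (U ∩ {e, π e}).card ≤ 2 := fun e he => by
    have hne : e ≠ π e := fun h => hπ' e h.symm
    exact (card_le_card inter_subset_right).trans (card_pair hne).le
  rw [prod_eq_pow_three (reps π S) (fun e => (U ∩ {e, π e}).card) hx F, h0, h1, h2]
  simp [hF]
  ring

end Fibres

/-! ### §4 The type class of the shell has product mass at least `(N+1)^{-3}` -/

/-- **The number of words of a given type**, over any finite index set (transport of the tree's
`card_words_eq_multinomial` along an enumeration). [cite: CoverThomas2005, Thm. 11.1.3] -/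
theorem card_typewords {ι α : Type*} [Fintype ι] [DecidableEq ι] [Fintype α] [DecidableEq α]
    (k : α → ℕ) (hk : ∑ a, k a = Fintype.card ι) :
    (univ.filter fun κ : ι → α => ∀ a, (univ.filter fun i => κ i = a).card = k a).card =
      Nat.multinomial univ k := by
  rw [← Literature.Computability.AlgebraicComplexity.card_words_eq_multinomial (Fintype.card ι) k hk]
  set e := Fintype.equivFin ι
  refine card_equiv (e.arrowCongr (Equiv.refl α)) fun κ => ?_
  simp only [mem_filter, mem_univ, true_and, Equiv.arrowCongr_apply, Equiv.coe_refl,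
    Function.comp_apply, id_eq]
  refine forall_congr' fun a => ?_
  rw [card_equiv e (t := univ.filter fun t : Fin (Fintype.card ι) => κ (e.symm t) = a)
    (fun i => by simp)]

section Types

variable (hπ : ∀ v, π (π v) = v) (hπ' : ∀ v, π v ≠ v)
include hπ hπ'

omit hπ hπ' in
/-- **The label vectors of the shell's type.** The label vectors whose word has `c` half, `s` full and
`N − c − s` untouched labels number `binom(N; c, s, N−c−s) · 2^N · c^c s^s (N−c−s)^{N−c−s}`.
[cite: CoverThomas2005, Thm. 11.1.3] -/
theorem card_typeCfg {S : Finset (Fin n)} {c s : ℕ} (hcs : c + s ≤ (reps π S).card) :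
    (univ.filter fun ω : reps π S → Fin (reps π S).card × Bool =>
        ∀ a : Fin 3, (univ.filter fun e => labelCat c s (ω e).1 = a).card =
          ![c, s, (reps π S).card - (c + s)] a).card =
      Nat.multinomial univ ![c, s, (reps π S).card - (c + s)] *
        (2 ^ (reps π S).card * ∏ a : Fin 3, ![c, s, (reps π S).card - (c + s)] a ^
          ![c, s, (reps π S).card - (c + s)] a) := by
  set N := (reps π S).card with hN
  set k : Fin 3 → ℕ := ![c, s, N - (c + s)] with hk
  have hksum : ∑ a, k a = Fintype.card (reps π S) := by
    rw [Fintype.card_coe, Fin.sum_univ_three]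
    simp only [hk, Matrix.cons_val_zero, Matrix.cons_val_one, Matrix.cons_val]
    omega
  set W := (univ.filter fun κ : reps π S → Fin 3 => ∀ a, (univ.filter fun i => κ i = a).card = k a)
    with hW
  rw [card_eq_sum_card_fiberwise (f := fun ω e => labelCat c s (ω e).1) (t := W)
    (fun ω hω => by simpa [hW] using hω)]
  have hfib : ∀ κ ∈ W, ((univ.filter fun ω : reps π S → Fin N × Bool =>
      ∀ a : Fin 3, (univ.filter fun e => labelCat c s (ω e).1 = a).card = k a).filter
        fun ω => (fun e => labelCat c s (ω e).1) = κ).card = 2 ^ N * ∏ a, k a ^ k a := by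
    intro κ hκ
    have hκ' : ∀ a, (univ.filter fun i => κ i = a).card = k a := by simpa [hW] using hκ
    have hset : ((univ.filter fun ω : reps π S → Fin N × Bool =>
        ∀ a : Fin 3, (univ.filter fun e => labelCat c s (ω e).1 = a).card = k a).filter
          fun ω => (fun e => labelCat c s (ω e).1) = κ) =
        Fintype.piFinset fun e : reps π S => univ.filter fun lb : Fin N × Bool => labelCat c s lb.1 = κ e := by
      ext ω
      simp only [mem_filter, mem_univ, true_and, Fintype.mem_piFinset, funext_iff]
      constructor
      · rintro ⟨-, h⟩; exact h
      · intro h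
        refine ⟨fun a => ?_, h⟩
        rw [← hκ' a]
        congr 1
        ext e
        simp only [mem_filter, mem_univ, true_and, h e]
    rw [hset, Fintype.card_piFinset]
    have hcoord : ∀ e : reps π S,
        (univ.filter fun lb : Fin N × Bool => labelCat c s lb.1 = κ e).card = 2 * k (κ e) := by
      intro e
      rw [card_filter_prod_bool]
      simp only
      rw [card_labels_cat c s hcs (κ e)]
      ring
    rw [prod_congr rfl fun e _ => hcoord e, prod_mul_distrib, prod_const, card_univ, Fintype.card_coe,
      ← hN]
    congr 1
    rw [← prod_fiberwise_of_maps_to' (t := univ) (g := κ) (fun e _ => mem_univ _) (f := k)]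
    refine prod_congr rfl fun a _ => ?_
    rw [prod_const, hκ' a]
  rw [sum_congr rfl hfib, sum_const, smul_eq_mul]
  congr 1
  rw [hW]
  convert card_typewords k hksum using 3

omit hπ hπ' in
/-- **Method of types**: `N^N ≤ (N+1)³ · binom(N; k) · ∏ₐ kₐ^{kₐ}` for `k = (c, s, N−c−s)` — the type class
of the label distribution is the likeliest (the tree's `one_le_card_pow_mul_typeClassMass_self`).
[cite: CoverThomas2005, Thm. 11.1.4] -/
theorem pow_le_typeMass {N c s : ℕ} (hcs : c + s ≤ N) :
    ((N : ℝ)) ^ N ≤ ((N : ℝ) + 1) ^ 3 * ((Nat.multinomial univ ![c, s, N - (c + s)] : ℝ) *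
      ∏ a : Fin 3, ((![c, s, N - (c + s)] a : ℕ) : ℝ) ^ ![c, s, N - (c + s)] a) := by
  set k : Fin 3 → ℕ := ![c, s, N - (c + s)] with hk
  have hksum : ∑ a, k a = N := by
    rw [Fin.sum_univ_three]
    simp only [hk, Matrix.cons_val_zero, Matrix.cons_val_one, Matrix.cons_val]
    omega
  have h := Literature.Computability.AlgebraicComplexity.one_le_card_pow_mul_typeClassMass_self k hksum
  rw [Fintype.card_fin] at h
  have hpow : (∏ a, ((k a : ℝ) / N) ^ k a) * (N : ℝ) ^ N = ∏ a, (k a : ℝ) ^ k a := by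
    simp_rw [div_pow]
    rw [prod_div_distrib, prod_pow_eq_pow_sum, hksum]
    have hNN : (N : ℝ) ^ N ≠ 0 := by
      rcases Nat.eq_zero_or_pos N with h0 | h0
      · subst h0; simp
      · exact pow_ne_zero _ (by exact_mod_cast h0.ne')
    rw [div_mul_cancel₀ _ hNN]
  have hNN : (0 : ℝ) ≤ (N : ℝ) ^ N := by positivity
  calc ((N : ℝ)) ^ N = 1 * (N : ℝ) ^ N := (one_mul _).symm
    _ ≤ ((N : ℝ) + 1) ^ 3 * ((Nat.multinomial univ k : ℝ) * ∏ a, ((k a : ℝ) / N) ^ k a) * (N : ℝ) ^ N :=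
        mul_le_mul_of_nonneg_right h hNN
    _ = ((N : ℝ) + 1) ^ 3 * ((Nat.multinomial univ k : ℝ) * ∏ a, (k a : ℝ) ^ k a) := by
        rw [← hpow]; ring

/-- **The shell carries at least a `(N+1)^{-3}` fraction of the product space**:
`(2N)^N ≤ (N+1)³ · #{ω : U(ω) ∈ Shell_S(c+2s, c)}`. [cite: FriezeKaronski2016, §1.1 Lemma 1.2 (PDF pp. 11–12)] -/
theorem typeCfg_lower {S : Finset (Fin n)} (hS : ∀ v ∈ S, π v ∈ S) {c s : ℕ}
    (hcs : c + s ≤ (reps π S).card) :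
    (2 * ((reps π S).card : ℝ)) ^ (reps π S).card ≤ (((reps π S).card : ℝ) + 1) ^ 3 *
      ((univ.filter fun ω : reps π S → Fin (reps π S).card × Bool =>
        cutOf π S c s ω ∈ shellIn π S (c + 2 * s) c).card : ℝ) := by
  set N := (reps π S).card with hN
  set k : Fin 3 → ℕ := ![c, s, N - (c + s)] with hk
  -- the type class is contained in the preimage of the shell
  have hsub : (univ.filter fun ω : reps π S → Fin N × Bool =>
        ∀ a : Fin 3, (univ.filter fun e => labelCat c s (ω e).1 = a).card = k a) ⊆
      (univ.filter fun ω : reps π S → Fin N × Bool => cutOf π S c s ω ∈ shellIn π S (c + 2 * s) c) := by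
    intro ω hω
    simp only [mem_filter, mem_univ, true_and] at hω ⊢
    refine cutOf_mem_shellIn hπ hπ' hS ω ?_ ?_
    · have h := hω 0
      simp only [hk, Matrix.cons_val_zero] at h
      have hset : (univ.filter fun e : reps π S => ((ω e).1 : ℕ) < c) =
          univ.filter fun e : reps π S => labelCat c s (ω e).1 = 0 := by
        ext e; simp only [mem_filter, mem_univ, true_and, labelCat_eq_zero_iff]
      rw [hset]; exact h
    · have h := hω 1
      simp only [hk, Matrix.cons_val_one, Matrix.cons_val_zero] at h
      have hset : (univ.filter fun e : reps π S => ¬ ((ω e).1 : ℕ) < c ∧ ((ω e).1 : ℕ) < c + s) =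
          univ.filter fun e : reps π S => labelCat c s (ω e).1 = 1 := by
        ext e; simp only [mem_filter, mem_univ, true_and, labelCat_eq_one_iff]
      rw [hset]; exact h
  have hcard := card_le_card hsub
  rw [card_typeCfg (π := π) hcs] at hcard
  have hcardR : ((Nat.multinomial univ k : ℝ) * (2 ^ N * ∏ a : Fin 3, ((k a : ℕ) : ℝ) ^ k a)) ≤
      ((univ.filter fun ω : reps π S → Fin N × Bool =>
        cutOf π S c s ω ∈ shellIn π S (c + 2 * s) c).card : ℝ) := by
    exact_mod_cast hcard
  have hmass := pow_le_typeMass (N := N) hcs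
  have h3 : (0 : ℝ) ≤ ((N : ℝ) + 1) ^ 3 := by positivity
  calc (2 * (N : ℝ)) ^ N = 2 ^ N * (N : ℝ) ^ N := by rw [mul_pow]
    _ ≤ 2 ^ N * (((N : ℝ) + 1) ^ 3 * ((Nat.multinomial univ k : ℝ) * ∏ a, ((k a : ℕ) : ℝ) ^ k a)) :=
        mul_le_mul_of_nonneg_left hmass (by positivity)
    _ = ((N : ℝ) + 1) ^ 3 * ((Nat.multinomial univ k : ℝ) * (2 ^ N * ∏ a, ((k a : ℕ) : ℝ) ^ k a)) := by
        ring
    _ ≤ ((N : ℝ) + 1) ^ 3 * ((univ.filter fun ω : reps π S → Fin N × Bool =>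
          cutOf π S c s ω ∈ shellIn π S (c + 2 * s) c).card : ℝ) :=
        mul_le_mul_of_nonneg_left hcardR h3

end Types

/-! ### §5 The edge terms: ranges, means, and Hoeffding's inequality on the product space -/

section Hoeffding

variable (hπ : ∀ v, π (π v) = v) (hπ' : ∀ v, π v ≠ v)
include hπ hπ'

omit hπ hπ' in
/-- A sum of `φ` over part of an edge lies between the sums of the negative and of the positive parts.
[cite: Hoeffding1963, Thm. 2 (bounded summands)] -/
theorem sum_piece_mem_Icc {T : Finset (Fin n)} {v : Fin n} (hne : v ≠ π v) (hT : T ⊆ {v, π v})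
    (φ : Fin n → ℝ) :
    ∑ w ∈ T, φ w ∈ Set.Icc (min (φ v) 0 + min (φ (π v)) 0) (max (φ v) 0 + max (φ (π v)) 0) := by
  constructor
  · calc min (φ v) 0 + min (φ (π v)) 0 = ∑ w ∈ ({v, π v} : Finset (Fin n)), min (φ w) 0 := by
          rw [sum_pair hne]
      _ ≤ ∑ w ∈ T, min (φ w) 0 :=
          sum_le_sum_of_subset_of_nonpos' hT fun w _ _ => min_le_right _ _
      _ ≤ ∑ w ∈ T, φ w := sum_le_sum fun w _ => min_le_left _ _
  · calc ∑ w ∈ T, φ w ≤ ∑ w ∈ T, max (φ w) 0 := sum_le_sum fun w _ => le_max_left _ _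
      _ ≤ ∑ w ∈ ({v, π v} : Finset (Fin n)), max (φ w) 0 :=
          sum_le_sum_of_subset_of_nonneg hT fun w _ _ => le_max_right _ _
      _ = max (φ v) 0 + max (φ (π v)) 0 := by rw [sum_pair hne]

omit hπ hπ' in
/-- The width of that interval is `|φ v| + |φ (π v)|`. [folklore] -/
private theorem max_sub_min_eq (x : ℝ) : max x 0 - min x 0 = |x| := by
  rcases le_total 0 x with h | h
  · rw [max_eq_left h, min_eq_right h, abs_of_nonneg h, sub_zero]
  · rw [max_eq_right h, min_eq_left h, abs_of_nonpos h, zero_sub]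

omit hπ in
/-- **The sum of an edge term over all labels**: `Σ_{(ℓ,β)} Σ_{w ∈ piece(ℓ,β)} φ(w) = (c + 2s)·(φ v + φ πv)`
(the half labels contribute `φ v + φ πv` once each, the full labels twice). [cite: Hoeffding1963, Thm. 2] -/
theorem sum_labels_piece {N c s : ℕ} (hcs : c + s ≤ N) (v : Fin n) (φ : Fin n → ℝ) :
    ∑ lb : Fin N × Bool, ∑ w ∈ piece π c s v lb, φ w = ((c + 2 * s : ℕ) : ℝ) * (φ v + φ (π v)) := by
  have hne : v ≠ π v := fun h => hπ' v h.symm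
  rw [Fintype.sum_prod_type]
  have hrow : ∀ ℓ : Fin N, ∑ b : Bool, ∑ w ∈ piece π c s v (ℓ, b), φ w =
      (φ v + φ (π v)) * (if (ℓ : ℕ) < c then 1 else if (ℓ : ℕ) < c + s then 2 else 0) := by
    intro ℓ
    rw [Fintype.sum_bool]
    by_cases h1 : (ℓ : ℕ) < c
    · have ht : piece π c s v (ℓ, true) = {v} := (piece_eq_singleton_iff hπ' c s v ℓ true).2 ⟨h1, rfl⟩
      have hf : piece π c s v (ℓ, false) = {π v} :=
        (piece_eq_singleton_partner_iff hπ' c s v ℓ false).2 ⟨h1, rfl⟩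
      rw [ht, hf, sum_singleton, sum_singleton, if_pos h1]; ring
    · by_cases h2 : (ℓ : ℕ) < c + s
      · have hp : ∀ b, piece π c s v (ℓ, b) = {v, π v} := fun b =>
          (piece_eq_pair_iff hπ' c s v ℓ b).2 ⟨h1, h2⟩
        rw [hp, hp, sum_pair hne, if_neg h1, if_pos h2]; ring
      · have hp : ∀ b, piece π c s v (ℓ, b) = ∅ := fun b => (piece_eq_empty_iff c s v ℓ b).2 h2
        rw [hp, hp, sum_empty, if_neg h1, if_neg h2]; ring
  rw [Fintype.sum_congr _ _ hrow, ← mul_sum]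
  have hcount : ∑ ℓ : Fin N, (if (ℓ : ℕ) < c then (1 : ℝ) else if (ℓ : ℕ) < c + s then 2 else 0) =
      (c + 2 * s : ℕ) := by
    have h : ∀ ℓ : Fin N, (if (ℓ : ℕ) < c then (1 : ℝ) else if (ℓ : ℕ) < c + s then 2 else 0) =
        (if (ℓ : ℕ) < c then (1 : ℝ) else 0) +
          2 * (if ¬ (ℓ : ℕ) < c ∧ (ℓ : ℕ) < c + s then (1 : ℝ) else 0) := by
      intro ℓ
      by_cases h1 : (ℓ : ℕ) < c <;> by_cases h2 : (ℓ : ℕ) < c + s <;> simp [h1, h2]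
    rw [Fintype.sum_congr _ _ h, sum_add_distrib, ← mul_sum, sum_boole, sum_boole,
      card_labels_lt c ((Nat.le_add_right c s).trans hcs), card_labels_mid c s hcs]
    push_cast; ring
  rw [hcount]; ring

/-- The mean of the statistic: `Σ_e (c+2s)(φ e + φ πe)/(2N) = (t/|S|)·Σ_{v∈S} φ(v)`, `t = c + 2s`.
[cite: Rothvoss2017, §2 (PDF p. 5)] -/
theorem sum_mean_eq {S : Finset (Fin n)} (hS : ∀ v ∈ S, π v ∈ S) (c s : ℕ) (φ : Fin n → ℝ) :
    ∑ e : reps π S, ((c + 2 * s : ℕ) : ℝ) * (φ e + φ (π e)) / (2 * (reps π S).card) =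
      ((c + 2 * s : ℕ) : ℝ) / S.card * ∑ w ∈ S, φ w := by
  rw [sum_eq_sum_reps hπ hπ' hS φ, ← sum_coe_sort (reps π S) (f := fun e => φ e + φ (π e))]
  have hS2 : (S.card : ℝ) = 2 * (reps π S).card := by
    rw [← two_mul_card_reps hπ hπ' hS]; push_cast; ring
  rw [hS2, mul_sum]
  refine sum_congr rfl fun e _ => ?_
  ring

/-- **Hoeffding on the product space, in the encoding's currency**: for `ε ≥ 0` and `R_φ > 0`,
`#{ω : |Σ_{w ∈ U(ω)} φ(w) − μ_φ| ≥ ε} ≤ 2·exp(−2ε²/R_φ)·(2N)^N`.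
[cite: Hoeffding1963, Thm. 2; DevroyeGyorfiLugosi1996, Thm. 8.1] -/
theorem card_dev_cfg_le {S : Finset (Fin n)} (hS : ∀ v ∈ S, π v ∈ S) {c s : ℕ}
    (hcs : c + s ≤ (reps π S).card) (φ : Fin n → ℝ) {ε : ℝ} (hε : 0 ≤ ε)
    (hR : 0 < ∑ e ∈ reps π S, (|φ e| + |φ (π e)|) ^ 2) :
    ((univ.filter fun ω : reps π S → Fin (reps π S).card × Bool =>
        ε ≤ |∑ w ∈ cutOf π S c s ω, φ w - ((c + 2 * s : ℕ) : ℝ) / S.card * ∑ w ∈ S, φ w|).card : ℝ) ≤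
      2 * Real.exp (-(2 * ε ^ 2 / ∑ e ∈ reps π S, (|φ e| + |φ (π e)|) ^ 2)) *
        (2 * ((reps π S).card : ℝ)) ^ (reps π S).card := by
  set N := (reps π S).card with hN
  -- the centred edge terms
  set m : reps π S → ℝ := fun e => ((c + 2 * s : ℕ) : ℝ) * (φ e + φ (π e)) / (2 * N) with hm
  set f : ∀ _e : reps π S, Fin N × Bool → ℝ :=
    fun e lb => ∑ w ∈ piece π c s (e : Fin n) lb, φ w - m e with hf
  set a : reps π S → ℝ := fun e => min (φ e) 0 + min (φ (π e)) 0 - m e with ha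
  set b : reps π S → ℝ := fun e => max (φ e) 0 + max (φ (π e)) 0 - m e with hb
  have hNpos : 0 < N := by
    by_contra h0
    have h0' : N = 0 := by omega
    have : reps π S = ∅ := card_eq_zero.1 (hN ▸ h0')
    rw [this, sum_empty] at hR
    exact lt_irrefl _ hR
  have hf0 : ∀ e, ∑ lb, f e lb = 0 := by
    intro e
    simp only [hf]
    rw [sum_sub_distrib, sum_labels_piece hπ' hcs (e : Fin n) φ, sum_const, card_univ,
      Fintype.card_prod, Fintype.card_fin, Fintype.card_bool, nsmul_eq_mul]
    simp only [hm]
    have hN0 : (N : ℝ) ≠ 0 := by exact_mod_cast hNpos.ne'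
    field_simp
    push_cast
    ring
  have hfI : ∀ e lb, f e lb ∈ Set.Icc (a e) (b e) := by
    intro e lb
    have hne : (e : Fin n) ≠ π e := fun h => hπ' e h.symm
    have h := sum_piece_mem_Icc hne (piece_subset_pair c s (e : Fin n) lb) φ
    simp only [hf, ha, hb, Set.mem_Icc] at h ⊢
    constructor <;> linarith [h.1, h.2]
  have hwidth : ∑ e, (b e - a e) ^ 2 = ∑ e ∈ reps π S, (|φ e| + |φ (π e)|) ^ 2 := by
    rw [← sum_coe_sort (reps π S) (f := fun e => (|φ e| + |φ (π e)|) ^ 2)]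
    refine sum_congr rfl fun e _ => ?_
    simp only [ha, hb]
    rw [← max_sub_min_eq (φ e), ← max_sub_min_eq (φ (π e))]
    ring
  have hRpos : 0 < ∑ e, (b e - a e) ^ 2 := by rw [hwidth]; exact hR
  have h := Literature.Probability.Moments.hoeffding_count_pi_Icc_abs
    (κ := fun _ : reps π S => Fin N × Bool) f a b hf0 hfI hε hRpos
  rw [hwidth] at h
  have hprod : ∏ _e : reps π S, (Fintype.card (Fin N × Bool) : ℝ) = (2 * (N : ℝ)) ^ N := by
    rw [prod_const, card_univ, Fintype.card_coe, Fintype.card_prod, Fintype.card_fin,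
      Fintype.card_bool, ← hN]
    push_cast; ring
  rw [hprod] at h
  refine le_trans (le_of_eq ?_) h
  congr 2
  ext ω
  simp only [mem_filter, mem_univ, true_and]
  rw [sum_cutOf hπ c s ω φ, ← sum_mean_eq hπ hπ' hS c s φ]
  simp only [hf, hm, sum_sub_distrib, ← hN]

end Hoeffding

/-! ### §6 Assembly: the tail bounds -/

section Tail

variable (hπ : ∀ v, π (π v) = v) (hπ' : ∀ v, π v ≠ v)
include hπ hπ'

/-- **Sub-Gaussian tail of a vertex-additive cut statistic on a shell (counting form).** For a
fixed-point-free involution `π`, a `π`-stable ground set `S` with `N` edges, a weight `φ`, `ε ≥ 0`: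
`#{U ∈ Shell_S(c+2s,c) : |Σ_{v∈U} φ(v) − (t/|S|)Σ_{v∈S}φ(v)| ≥ ε} ≤ 2(N+1)³·exp(−2ε²/R_φ)·#Shell_S(c+2s,c)`,
`R_φ = Σ_{e ∈ reps S} (|φ e| + |φ πe|)²`, `t = c + 2s`. (Method of types + Hoeffding; the polynomial
factor is an artefact, see the module docstring.)
[cite: Hoeffding1963, Thm. 2; CoverThomas2005, Thm. 11.1.4; FriezeKaronski2016, §1.1 Lemma 1.2 (PDF pp. 11–12)] -/
theorem card_shellIn_filter_dev_le {S : Finset (Fin n)} (hS : ∀ v ∈ S, π v ∈ S) (φ : Fin n → ℝ)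
    (c s : ℕ) {ε : ℝ} (hε : 0 ≤ ε) :
    (((shellIn π S (c + 2 * s) c).filter fun U =>
        ε ≤ |∑ w ∈ U, φ w - ((c + 2 * s : ℕ) : ℝ) / S.card * ∑ w ∈ S, φ w|).card : ℝ) ≤
      2 * (((reps π S).card : ℝ) + 1) ^ 3 *
        Real.exp (-(2 * ε ^ 2 / ∑ e ∈ reps π S, (|φ e| + |φ (π e)|) ^ 2)) *
          (shellIn π S (c + 2 * s) c).card := by
  set N := (reps π S).card with hN
  set μ : ℝ := ((c + 2 * s : ℕ) : ℝ) / S.card * ∑ w ∈ S, φ w with hμ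
  set R : ℝ := ∑ e ∈ reps π S, (|φ e| + |φ (π e)|) ^ 2 with hRdef
  set Sh := shellIn π S (c + 2 * s) c with hSh
  set A := Sh.filter fun U => ε ≤ |∑ w ∈ U, φ w - μ| with hA
  have hA_le : (A.card : ℝ) ≤ Sh.card := by exact_mod_cast card_le_card (filter_subset _ _)
  have hpoly : (1 : ℝ) ≤ 2 * ((N : ℝ) + 1) ^ 3 := by
    have : (1 : ℝ) ≤ ((N : ℝ) + 1) ^ 3 := one_le_pow₀ (by linarith [(Nat.cast_nonneg N : (0:ℝ) ≤ N)])
    linarith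
  -- degenerate case: `R = 0` (then the exponential is `1`)
  by_cases hR : R = 0
  · rw [hR, div_zero, neg_zero, Real.exp_zero, mul_one]
    calc (A.card : ℝ) ≤ Sh.card := hA_le
      _ = 1 * Sh.card := (one_mul _).symm
      _ ≤ 2 * ((N : ℝ) + 1) ^ 3 * Sh.card := mul_le_mul_of_nonneg_right hpoly (Nat.cast_nonneg _)
  have hRpos : 0 < R := lt_of_le_of_ne (sum_nonneg fun e _ => sq_nonneg _) (Ne.symm hR)
  -- empty shell: nothing to prove
  by_cases hne : Sh.Nonempty
  swap
  · rw [not_nonempty_iff_eq_empty] at hne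
    have hA0 : A = ∅ := by rw [hA, hne, filter_empty]
    rw [hA0, hne, card_empty]; simp
  obtain ⟨U₀, hU₀⟩ := hne
  have hcs : c + s ≤ N := (localType_counts hπ hπ' hS hU₀).2.2.2
  -- the common fibre size
  set K : ℕ := c ^ c * (2 * s) ^ s * (2 * (N - (c + s))) ^ (N - (c + s)) with hK
  have hKpos : (0 : ℝ) < K := by
    have hpow : ∀ a b : ℕ, (a = 0 → b = 0) → 0 < a ^ b := fun a b h => by
      rcases Nat.eq_zero_or_pos a with ha | ha
      · rw [ha, h ha, pow_zero]; exact Nat.one_pos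
      · exact pow_pos ha b
    have hK0 : 0 < K :=
      Nat.mul_pos (Nat.mul_pos (hpow c c id) (hpow _ _ (by omega))) (hpow _ _ (by omega))
    exact_mod_cast hK0
  -- (1) `#A · K = #{ω : U(ω) ∈ A}`
  have hfib : ∀ B ⊆ Sh, ((univ.filter fun ω : reps π S → Fin N × Bool => cutOf π S c s ω ∈ B).card : ℝ)
      = B.card * K := by
    intro B hB
    rw [card_eq_sum_card_fiberwise (s := univ.filter fun ω : reps π S → Fin N × Bool => cutOf π S c s ω ∈ B)
      (f := fun ω => cutOf π S c s ω) (t := B) (fun ω hω => (mem_filter.1 hω).2)]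
    have : ∀ U ∈ B, ((univ.filter fun ω : reps π S → Fin N × Bool => cutOf π S c s ω ∈ B).filter
        fun ω => cutOf π S c s ω = U).card = K := by
      intro U hUB
      rw [filter_filter]
      have : (univ.filter fun ω : reps π S → Fin N × Bool => cutOf π S c s ω ∈ B ∧ cutOf π S c s ω = U)
          = univ.filter fun ω => cutOf π S c s ω = U := by
        ext ω; simp only [mem_filter, mem_univ, true_and]
        exact ⟨fun h => h.2, fun h => ⟨h ▸ hUB, h⟩⟩
      rw [this, hK, hN]
      exact card_fibre_eq hπ hπ' hS (hB hUB)
    rw [sum_congr rfl this, sum_const, smul_eq_mul]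
    push_cast; ring
  -- (2) `#{ω : U(ω) ∈ A} ≤ #{ω : deviation} ≤ 2 e^{-2ε²/R} (2N)^N`
  have hdev : ((univ.filter fun ω : reps π S → Fin N × Bool => cutOf π S c s ω ∈ A).card : ℝ) ≤
      2 * Real.exp (-(2 * ε ^ 2 / R)) * (2 * (N : ℝ)) ^ N := by
    refine le_trans ?_ (card_dev_cfg_le hπ hπ' hS hcs φ hε hRpos)
    exact_mod_cast card_le_card fun ω hω => by
      simp only [mem_filter, mem_univ, true_and, hA] at hω ⊢
      exact hω.2
  -- (3) `(2N)^N ≤ (N+1)^3 · #Sh · K`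
  have hlow : (2 * (N : ℝ)) ^ N ≤ ((N : ℝ) + 1) ^ 3 * (Sh.card * K) := by
    rw [← hfib Sh Subset.rfl]
    exact typeCfg_lower hπ hπ' hS hcs
  -- assembly
  have hAK : (A.card : ℝ) * K ≤ 2 * Real.exp (-(2 * ε ^ 2 / R)) * (((N : ℝ) + 1) ^ 3 * (Sh.card * K)) := by
    rw [← hfib A (filter_subset _ _)]
    exact hdev.trans (mul_le_mul_of_nonneg_left hlow (by positivity))
  have : (A.card : ℝ) * K ≤ (2 * ((N : ℝ) + 1) ^ 3 * Real.exp (-(2 * ε ^ 2 / R)) * Sh.card) * K := by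
    calc (A.card : ℝ) * K ≤ _ := hAK
      _ = (2 * ((N : ℝ) + 1) ^ 3 * Real.exp (-(2 * ε ^ 2 / R)) * Sh.card) * K := by ring
  exact le_of_mul_le_mul_right this hKpos

omit hπ hπ' in
/-- The block statistic is vertex-additive: `Σ_{w ∈ U} 1_H(w) = |U ∩ H|`. [folklore] -/
private theorem sum_indicator_eq_card_inter (U H : Finset (Fin n)) :
    ∑ w ∈ U, (if w ∈ H then (1 : ℝ) else 0) = ((U ∩ H).card : ℝ) := by
  rw [sum_boole, filter_mem_eq_inter]

/-- The range term of the indicator weight: `Σ_e ([e ∈ H] + [πe ∈ H])² ≤ 2|S ∩ H|`. [folklore] -/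
private theorem sum_sq_indicator_le {S : Finset (Fin n)} (hS : ∀ v ∈ S, π v ∈ S) (H : Finset (Fin n)) :
    ∑ e ∈ reps π S, (|(if (e : Fin n) ∈ H then (1 : ℝ) else 0)| + |(if π e ∈ H then (1 : ℝ) else 0)|) ^ 2
      ≤ 2 * ((S ∩ H).card : ℝ) := by
  rw [← sum_indicator_eq_card_inter S H, sum_eq_sum_reps hπ hπ' hS, mul_sum]
  refine sum_le_sum fun e _ => ?_
  by_cases h1 : (e : Fin n) ∈ H <;> by_cases h2 : π e ∈ H <;> norm_num [h1, h2]

/-- **Sub-Gaussian tail of the block statistic `|U ∩ H|` on a shell (law form).** For every `t, c`,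
`ε ≥ 0` and every finite set `X` of values with `|x − t|S ∩ H|/|S|| ≥ ε` on `X`:
`Σ_{x ∈ X} law_S(t,c;x) ≤ 2(N+1)³ · exp(−ε²/|S ∩ H|)` (`N` = number of edges of `S`; an empty shell or
`S ∩ H = ∅` are trivial cases; the mean of `|U ∩ H|` under the uniform measure on any nonempty
`Shell_S(t,c)` is `t|S ∩ H|/|S|`). [cite: Hoeffding1963, Thm. 2; CoverThomas2005, Thm. 11.1.4; Rothvoss2017, §2 (PDF pp. 5–6)] -/
theorem sum_shellLaw_le_of_dev {S : Finset (Fin n)} (hS : ∀ v ∈ S, π v ∈ S) (H : Finset (Fin n))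
    (t c : ℕ) {ε : ℝ} (hε : 0 ≤ ε) (X : Finset ℤ)
    (hX : ∀ x ∈ X, ε ≤ |(x : ℝ) - (t : ℝ) * (S ∩ H).card / S.card|) :
    ∑ x ∈ X, shellLaw π S H t c x ≤
      2 * (((reps π S).card : ℝ) + 1) ^ 3 * Real.exp (-(ε ^ 2 / (S ∩ H).card)) := by
  set N := (reps π S).card with hN
  have hRHS : 0 ≤ 2 * ((N : ℝ) + 1) ^ 3 * Real.exp (-(ε ^ 2 / (S ∩ H).card)) := by positivity
  -- empty shell: every law value is `0`
  by_cases hSh : (shellIn π S t c).card = 0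
  · have h0 : ∀ x, shellLaw π S H t c x = 0 := fun x => by
      rw [shellLaw, hSh, Nat.cast_zero, div_zero]
    simp only [h0, sum_const_zero]
    exact hRHS
  -- nonempty shell: `t = c + 2s`
  obtain ⟨U₀, hU₀⟩ := card_pos.1 (Nat.pos_of_ne_zero hSh)
  have hct : c ≤ t := by
    have h := mem_shellIn.1 hU₀
    rw [← h.2.1, ← h.2.2]; exact card_le_card (half_subset _)
  have hfull := card_full_of_mem_shellIn hU₀
  have hfst : ∀ w ∈ full π U₀, π w ∈ full π U₀ := fun w hw => by
    rw [mem_full] at hw ⊢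
    exact ⟨hw.2, by rw [hπ]; exact hw.1⟩
  have heven : 2 * (reps π (full π U₀)).card = t - c := by
    rw [two_mul_card_reps hπ hπ' hfst, hfull]
  set s := (reps π (full π U₀)).card with hs
  have ht : t = c + 2 * s := by omega
  subst ht
  -- the law sum is a count of shell elements, bounded by the deviation count
  set φ : Fin n → ℝ := fun w => if w ∈ H then 1 else 0 with hφ
  have hμ : ((c + 2 * s : ℕ) : ℝ) / S.card * ∑ w ∈ S, φ w = ((c + 2 * s : ℕ) : ℝ) * (S ∩ H).card / S.card := by
    rw [sum_indicator_eq_card_inter]; ring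
  have hcount : ∑ x ∈ X, shellCount π S H (c + 2 * s) c x ≤
      (((shellIn π S (c + 2 * s) c).filter fun U =>
        ε ≤ |∑ w ∈ U, φ w - ((c + 2 * s : ℕ) : ℝ) / S.card * ∑ w ∈ S, φ w|).card : ℝ) := by
    have hfw := card_eq_sum_card_fiberwise
      (s := (shellIn π S (c + 2 * s) c).filter fun U => ((U ∩ H).card : ℤ) ∈ X)
      (f := fun U => ((U ∩ H).card : ℤ)) (t := X) (fun U hU => (mem_filter.1 hU).2)
    have h1 : ∑ x ∈ X, shellCount π S H (c + 2 * s) c x =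
        (((shellIn π S (c + 2 * s) c).filter fun U => ((U ∩ H).card : ℤ) ∈ X).card : ℝ) := by
      rw [hfw]
      push_cast
      refine sum_congr rfl fun x hx => ?_
      simp only [shellCount]
      congr 2
      rw [filter_filter]
      ext U
      simp only [mem_filter]
      constructor
      · rintro ⟨hU, h⟩; exact ⟨hU, by rw [h]; exact hx, h⟩
      · rintro ⟨hU, _, h⟩; exact ⟨hU, h⟩
    rw [h1]
    exact_mod_cast card_le_card fun U hU => by
      simp only [mem_filter] at hU ⊢
      refine ⟨hU.1, ?_⟩
      rw [hμ]
      simp only [hφ]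
      rw [sum_indicator_eq_card_inter]
      have := hX _ hU.2
      push_cast at this ⊢
      exact this
  have hmain := card_shellIn_filter_dev_le hπ hπ' hS φ c s hε
  -- compare the exponents: `R_φ ≤ 2|S ∩ H|`
  have hR := sum_sq_indicator_le hπ hπ' hS H
  have hexp : Real.exp (-(2 * ε ^ 2 / ∑ e ∈ reps π S, (|φ e| + |φ (π e)|) ^ 2)) ≤
      Real.exp (-(ε ^ 2 / (S ∩ H).card)) := by
    simp only [hφ] at hR ⊢
    set R := ∑ e ∈ reps π S,
      (|(if (e : Fin n) ∈ H then (1 : ℝ) else 0)| + |(if π e ∈ H then (1 : ℝ) else 0)|) ^ 2 with hRdef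
    by_cases hR0 : R = 0
    · -- then `S ∩ H = ∅` as well? not needed: `R = 0` forces `|S ∩ H| ≥ 0`; compare via `R ≤ 2|S∩H|`
      rw [hR0, div_zero, neg_zero, Real.exp_zero]
      -- `R = 0` ⇒ every endpoint of every edge misses `H` ⇒ `S ∩ H = ∅`
      have hSH : ((S ∩ H).card : ℝ) = 0 := by
        rw [← sum_indicator_eq_card_inter S H, sum_eq_sum_reps hπ hπ' hS]
        have hterm : ∀ e ∈ reps π S,
            (|(if (e : Fin n) ∈ H then (1 : ℝ) else 0)| + |(if π e ∈ H then (1 : ℝ) else 0)|) ^ 2 = 0 :=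
          fun e he => (sum_eq_zero_iff_of_nonneg fun e _ => sq_nonneg _).1 hR0 e he
        refine sum_eq_zero fun e he => ?_
        have h := hterm e he
        by_cases h1 : (e : Fin n) ∈ H <;> by_cases h2 : π e ∈ H <;> simp [h1, h2] at h ⊢
      rw [hSH, div_zero, neg_zero, Real.exp_zero]
    · have hRpos : 0 < R := lt_of_le_of_ne (sum_nonneg fun e _ => sq_nonneg _) (Ne.symm hR0)
      have hSHpos : 0 < ((S ∩ H).card : ℝ) := by linarith
      refine Real.exp_le_exp.2 (neg_le_neg ?_)
      rw [div_le_div_iff₀ hSHpos hRpos]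
      nlinarith [sq_nonneg ε]
  calc ∑ x ∈ X, shellLaw π S H (c + 2 * s) c x
      = (∑ x ∈ X, shellCount π S H (c + 2 * s) c x) / (shellIn π S (c + 2 * s) c).card := by
        rw [sum_div]; rfl
    _ ≤ (((shellIn π S (c + 2 * s) c).filter fun U =>
          ε ≤ |∑ w ∈ U, φ w - ((c + 2 * s : ℕ) : ℝ) / S.card * ∑ w ∈ S, φ w|).card : ℝ) /
          (shellIn π S (c + 2 * s) c).card :=
        div_le_div_of_nonneg_right hcount (Nat.cast_nonneg _)
    _ ≤ 2 * ((N : ℝ) + 1) ^ 3 * Real.exp (-(2 * ε ^ 2 / ∑ e ∈ reps π S, (|φ e| + |φ (π e)|) ^ 2)) := by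
        rw [div_le_iff₀ (Nat.cast_pos.2 (Nat.pos_of_ne_zero hSh))]
        exact hmain
    _ ≤ 2 * ((N : ℝ) + 1) ^ 3 * Real.exp (-(ε ^ 2 / (S ∩ H).card)) :=
        mul_le_mul_of_nonneg_left hexp (mul_nonneg zero_le_two (pow_nonneg (Nat.cast_add_one_pos N).le 3))

/-- **The `[TAIL]` input for the whole vertex set.** For a fixed-point-free involution `π` of `Fin n`, a
block `H`, any `t, c`, `ε ≥ 0` and any finite `X ⊆ {x : |x − t|H|/n| ≥ ε}`:
`Σ_{x ∈ X} law(t,c;x) ≤ 2(n/2 + 1)³ · exp(−ε²/|H|)`, `law(t,c;x) = P_{U ~ Shell_c}(|U ∩ H| = x)` for the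
uniform measure on the cuts of size `t` with `c` half-matched vertices (`shellLaw π univ H t c x`).
With `ε = K√(nD)` this is `≤ 2(n/2+1)³e^{−K²nD/|H|} ≤ 2(n/2+1)³e^{−K²D}`.
[cite: Hoeffding1963, Thm. 2; CoverThomas2005, Thm. 11.1.4; Rothvoss2017, §2 (PDF pp. 5–6)] -/
theorem sum_shellLaw_univ_le_of_dev (H : Finset (Fin n)) (t c : ℕ) {ε : ℝ} (hε : 0 ≤ ε)
    (X : Finset ℤ) (hX : ∀ x ∈ X, ε ≤ |(x : ℝ) - (t : ℝ) * H.card / n|) :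
    ∑ x ∈ X, shellLaw π univ H t c x ≤ 2 * ((n : ℝ) / 2 + 1) ^ 3 * Real.exp (-(ε ^ 2 / H.card)) := by
  have hS : ∀ v ∈ (univ : Finset (Fin n)), π v ∈ univ := fun _ _ => mem_univ _
  have hreps : (((reps π univ).card : ℝ)) = (n : ℝ) / 2 := by
    have h := two_mul_card_reps hπ hπ' hS
    rw [card_univ, Fintype.card_fin] at h
    rw [eq_div_iff (two_ne_zero), mul_comm]
    exact_mod_cast h
  have h := sum_shellLaw_le_of_dev hπ hπ' hS H t c hε X (fun x hx => by
    have := hX x hx; rwa [univ_inter, card_univ, Fintype.card_fin])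
  rwa [univ_inter, hreps] at h


/-! ### §7 Corollaries in the consumers' shapes: the block statistic in counting form, two blocks, and the
summed tail over the odd levels of a design (brick 121's `[TAIL]` term) -/

/-- Comparison of the exponents for the indicator weight: `exp(−2ε²/R_{1_H}) ≤ exp(−ε²/|S ∩ H|)` (with the
conventions `x/0 = 0` on both sides). [folklore] -/
private theorem exp_indicator_le {S : Finset (Fin n)} (hS : ∀ v ∈ S, π v ∈ S) (H : Finset (Fin n)) (ε : ℝ) :
    Real.exp (-(2 * ε ^ 2 / ∑ e ∈ reps π S,
        (|(if (e : Fin n) ∈ H then (1 : ℝ) else 0)| + |(if π e ∈ H then (1 : ℝ) else 0)|) ^ 2)) ≤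
      Real.exp (-(ε ^ 2 / (S ∩ H).card)) := by
  have hR := sum_sq_indicator_le hπ hπ' hS H
  set R := ∑ e ∈ reps π S,
    (|(if (e : Fin n) ∈ H then (1 : ℝ) else 0)| + |(if π e ∈ H then (1 : ℝ) else 0)|) ^ 2 with hRdef
  by_cases hR0 : R = 0
  · rw [hR0, div_zero, neg_zero, Real.exp_zero]
    have hSH : ((S ∩ H).card : ℝ) = 0 := by
      rw [← sum_indicator_eq_card_inter S H, sum_eq_sum_reps hπ hπ' hS]
      have hterm : ∀ e ∈ reps π S,
          (|(if (e : Fin n) ∈ H then (1 : ℝ) else 0)| + |(if π e ∈ H then (1 : ℝ) else 0)|) ^ 2 = 0 :=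
        fun e he => (sum_eq_zero_iff_of_nonneg fun e _ => sq_nonneg _).1 hR0 e he
      refine sum_eq_zero fun e he => ?_
      have h := hterm e he
      by_cases h1 : (e : Fin n) ∈ H <;> by_cases h2 : π e ∈ H <;> simp [h1, h2] at h ⊢
    rw [hSH, div_zero, neg_zero, Real.exp_zero]
  · have hRpos : 0 < R := lt_of_le_of_ne (sum_nonneg fun e _ => sq_nonneg _) (Ne.symm hR0)
    have hSHpos : 0 < ((S ∩ H).card : ℝ) := by linarith
    refine Real.exp_le_exp.2 (neg_le_neg ?_)
    rw [div_le_div_iff₀ hSHpos hRpos]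
    nlinarith [sq_nonneg ε]

/-- **The block statistic, counting form.** For a `π`-stable `S` with `N` edges, a block `H`, `ε ≥ 0`:
`#{U ∈ Shell_S(c+2s,c) : ||U ∩ H| − (c+2s)|S∩H|/|S|| ≥ ε} ≤ 2(N+1)³·exp(−ε²/|S ∩ H|)·#Shell_S(c+2s,c)`.
[cite: Hoeffding1963, Thm. 2; CoverThomas2005, Thm. 11.1.4; Rothvoss2017, §2 (PDF pp. 5–6)] -/
theorem card_shellIn_filter_dev_inter_le {S : Finset (Fin n)} (hS : ∀ v ∈ S, π v ∈ S) (H : Finset (Fin n))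
    (c s : ℕ) {ε : ℝ} (hε : 0 ≤ ε) :
    (((shellIn π S (c + 2 * s) c).filter fun U =>
        ε ≤ |((U ∩ H).card : ℝ) - ((c + 2 * s : ℕ) : ℝ) * (S ∩ H).card / S.card|).card : ℝ) ≤
      2 * (((reps π S).card : ℝ) + 1) ^ 3 * Real.exp (-(ε ^ 2 / (S ∩ H).card)) *
        (shellIn π S (c + 2 * s) c).card := by
  set φ : Fin n → ℝ := fun w => if w ∈ H then 1 else 0 with hφ
  have hmain := card_shellIn_filter_dev_le hπ hπ' hS φ c s hε
  have hset : ((shellIn π S (c + 2 * s) c).filter fun U =>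
        ε ≤ |((U ∩ H).card : ℝ) - ((c + 2 * s : ℕ) : ℝ) * (S ∩ H).card / S.card|) =
      ((shellIn π S (c + 2 * s) c).filter fun U =>
        ε ≤ |∑ w ∈ U, φ w - ((c + 2 * s : ℕ) : ℝ) / S.card * ∑ w ∈ S, φ w|) := by
    refine filter_congr fun U _ => ?_
    simp only [hφ]
    rw [sum_indicator_eq_card_inter, sum_indicator_eq_card_inter, mul_comm_div, ← mul_div_assoc, mul_comm]
  rw [hset]
  refine hmain.trans (mul_le_mul_of_nonneg_right (mul_le_mul_of_nonneg_left ?_ (by positivity))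
    (Nat.cast_nonneg _))
  exact exp_indicator_le hπ hπ' hS H ε

/-- **Two blocks** (for the two-block statistics `(|U ∩ H₁|, |U ∩ H₂|)`): the cuts deviating by `ε` in EITHER
block number at most `2(N+1)³·(e^{−ε²/|S∩H₁|} + e^{−ε²/|S∩H₂|})·#Shell` (union bound over the one-block tails).
[cite: Hoeffding1963, Thm. 2; CoverThomas2005, Thm. 11.1.4] -/
theorem card_shellIn_filter_dev_two_blocks_le {S : Finset (Fin n)} (hS : ∀ v ∈ S, π v ∈ S)
    (H₁ H₂ : Finset (Fin n)) (c s : ℕ) {ε : ℝ} (hε : 0 ≤ ε) :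
    (((shellIn π S (c + 2 * s) c).filter fun U =>
        ε ≤ |((U ∩ H₁).card : ℝ) - ((c + 2 * s : ℕ) : ℝ) * (S ∩ H₁).card / S.card| ∨
        ε ≤ |((U ∩ H₂).card : ℝ) - ((c + 2 * s : ℕ) : ℝ) * (S ∩ H₂).card / S.card|).card : ℝ) ≤
      2 * (((reps π S).card : ℝ) + 1) ^ 3 *
        (Real.exp (-(ε ^ 2 / (S ∩ H₁).card)) + Real.exp (-(ε ^ 2 / (S ∩ H₂).card))) *
          (shellIn π S (c + 2 * s) c).card := by
  have h₁ := card_shellIn_filter_dev_inter_le hπ hπ' hS H₁ c s hε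
  have h₂ := card_shellIn_filter_dev_inter_le hπ hπ' hS H₂ c s hε
  set A₁ := (shellIn π S (c + 2 * s) c).filter fun U =>
    ε ≤ |((U ∩ H₁).card : ℝ) - ((c + 2 * s : ℕ) : ℝ) * (S ∩ H₁).card / S.card| with hA₁
  set A₂ := (shellIn π S (c + 2 * s) c).filter fun U =>
    ε ≤ |((U ∩ H₂).card : ℝ) - ((c + 2 * s : ℕ) : ℝ) * (S ∩ H₂).card / S.card| with hA₂
  rw [filter_or]
  have hu : ((A₁ ∪ A₂).card : ℝ) ≤ (A₁.card : ℝ) + A₂.card := by exact_mod_cast card_union_le A₁ A₂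
  refine hu.trans ((add_le_add h₁ h₂).trans (le_of_eq ?_))
  ring

/-- **The `[TAIL]` term of the virtual-positivity criterion (brick 121), summed over the odd levels of a
degree-`D` design.** For any window `B` and any finite index set `s` of block values with `|x − t|H|/n| ≥ ε` on
`s ∖ B`: `Σ_{x ∈ s∖B} Σ_{j ≤ D} law(t, 2j+1; x) ≤ (D+1)·2(n/2+1)³·exp(−ε²/|H|)`. With `ε = K√(nD)` and `|H| ≤ n`
the right side is `≤ (D+1)·2(n/2+1)³·e^{−K²D}`.
[cite: Hoeffding1963, Thm. 2; CoverThomas2005, Thm. 11.1.4; Rothvoss2017, §2 (PDF pp. 5–6)] -/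
theorem sum_sdiff_sum_levels_shellLaw_le (H : Finset (Fin n)) (t D : ℕ) {ε : ℝ} (hε : 0 ≤ ε)
    (s B : Finset ℤ) (hsB : ∀ x ∈ s \ B, ε ≤ |(x : ℝ) - (t : ℝ) * H.card / n|) :
    ∑ x ∈ s \ B, ∑ j ∈ range (D + 1), shellLaw π univ H t (2 * j + 1) x ≤
      ((D : ℝ) + 1) * (2 * ((n : ℝ) / 2 + 1) ^ 3 * Real.exp (-(ε ^ 2 / H.card))) := by
  rw [sum_comm]
  calc ∑ j ∈ range (D + 1), ∑ x ∈ s \ B, shellLaw π univ H t (2 * j + 1) x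
      ≤ ∑ _j ∈ range (D + 1), 2 * ((n : ℝ) / 2 + 1) ^ 3 * Real.exp (-(ε ^ 2 / H.card)) :=
        sum_le_sum fun j _ => sum_shellLaw_univ_le_of_dev hπ hπ' H t (2 * j + 1) hε (s \ B) hsB
    _ = ((D : ℝ) + 1) * (2 * ((n : ℝ) / 2 + 1) ^ 3 * Real.exp (-(ε ^ 2 / H.card))) := by
        rw [sum_const, card_range, nsmul_eq_mul]; push_cast; ring


/-! ### §8 Edge-additive statistics: the same tail for `Ψ(U) = Σ_e ψ_e(U ∩ {e, πe})` with an arbitrary kernel on the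
four possible traces (the mixing variables of the half-set decomposition — `|half(U) ∩ H|`, the number of full `HH`
edges, … — are of this form but are not vertex sums) -/

/-- The mean of the edge term `ψ_e(U ∩ {e, πe})` under the label encoding: the trace is `{e}` or `{πe}` for `c/(2N)` of
the labels each, the whole edge for `s/N`, empty for `(N−c−s)/N` (plumbing def). [cite: Hoeffding1963, Thm. 2] -/
def edgeMean (π : Fin n → Fin n) (S : Finset (Fin n)) (c s : ℕ) (ψ : Fin n → Finset (Fin n) → ℝ) (e : Fin n) : ℝ :=
  ((c : ℝ) * (ψ e {e} + ψ e {π e}) + 2 * (s : ℝ) * ψ e {e, π e} +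
      2 * (((reps π S).card - (c + s) : ℕ) : ℝ) * ψ e ∅) / (2 * (reps π S).card)

omit hπ in
/-- **The sum of an edge kernel over all labels**:
`Σ_{(ℓ,β)} ψ(piece(ℓ,β)) = c·(ψ{v} + ψ{πv}) + 2s·ψ{v,πv} + 2(N−c−s)·ψ ∅`. [cite: Hoeffding1963, Thm. 2] -/
theorem sum_labels_piece_kernel {N c s : ℕ} (hcs : c + s ≤ N) (v : Fin n) (ψ : Finset (Fin n) → ℝ) :
    ∑ lb : Fin N × Bool, ψ (piece π c s v lb) =
      (c : ℝ) * (ψ {v} + ψ {π v}) + 2 * (s : ℝ) * ψ {v, π v} + 2 * ((N - (c + s) : ℕ) : ℝ) * ψ ∅ := by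
  rw [Fintype.sum_prod_type]
  have hrow : ∀ ℓ : Fin N, ∑ b : Bool, ψ (piece π c s v (ℓ, b)) =
      (if (ℓ : ℕ) < c then ψ {v} + ψ {π v} else 0) +
        ((if ¬ (ℓ : ℕ) < c ∧ (ℓ : ℕ) < c + s then 2 * ψ {v, π v} else 0) +
          (if ¬ (ℓ : ℕ) < c + s then 2 * ψ ∅ else 0)) := by
    intro ℓ
    rw [Fintype.sum_bool]
    by_cases h1 : (ℓ : ℕ) < c
    · rw [(piece_eq_singleton_iff hπ' c s v ℓ true).2 ⟨h1, rfl⟩,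
        (piece_eq_singleton_partner_iff hπ' c s v ℓ false).2 ⟨h1, rfl⟩]
      have h2 : (ℓ : ℕ) < c + s := by omega
      simp [h1, h2]
    · by_cases h2 : (ℓ : ℕ) < c + s
      · rw [(piece_eq_pair_iff hπ' c s v ℓ true).2 ⟨h1, h2⟩, (piece_eq_pair_iff hπ' c s v ℓ false).2 ⟨h1, h2⟩]
        simp [h1, h2]; ring
      · rw [(piece_eq_empty_iff c s v ℓ true).2 h2, (piece_eq_empty_iff c s v ℓ false).2 h2]
        simp [h1, h2]; ring
  rw [Fintype.sum_congr _ _ hrow, sum_add_distrib, sum_add_distrib, ← sum_filter, ← sum_filter, ← sum_filter,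
    sum_const, sum_const, sum_const, card_labels_lt c ((Nat.le_add_right c s).trans hcs), card_labels_mid c s hcs,
    card_labels_ge c s hcs]
  simp only [nsmul_eq_mul]
  ring

omit hπ' in
/-- An edge-additive statistic of the encoded cut is the sum of its edge terms:
`Σ_{e ∈ reps S} ψ_e(U(ω) ∩ {e, πe}) = Σ_e ψ_e(piece_e(ω_e))`. [cite: Hoeffding1963, Thm. 2 (independent summands)] -/
theorem sum_kernel_cutOf {S : Finset (Fin n)} (c s : ℕ) (ω : reps π S → Fin (reps π S).card × Bool)
    (ψ : Fin n → Finset (Fin n) → ℝ) :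
    ∑ e ∈ reps π S, ψ e (cutOf π S c s ω ∩ {e, π e}) = ∑ e : reps π S, ψ e (piece π c s (e : Fin n) (ω e)) := by
  rw [← sum_coe_sort (reps π S)]
  exact sum_congr rfl fun e _ => by rw [cutOf_inter_pair hπ c s ω e]

/-- **The fibre count**: for `B ⊆ Shell_S(c+2s, c)`, `#{ω : U(ω) ∈ B} = #B · c^c (2s)^s (2(N−c−s))^{N−c−s}`.
[cite: FriezeKaronski2016, §1.1 Lemma 1.1 (PDF p. 10)] -/
theorem card_filter_cutOf_mem_eq {S : Finset (Fin n)} (hS : ∀ v ∈ S, π v ∈ S) {c s : ℕ}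
    {B : Finset (Finset (Fin n))} (hB : B ⊆ shellIn π S (c + 2 * s) c) :
    (univ.filter fun ω : reps π S → Fin (reps π S).card × Bool => cutOf π S c s ω ∈ B).card =
      B.card * (c ^ c * (2 * s) ^ s *
        (2 * ((reps π S).card - (c + s))) ^ ((reps π S).card - (c + s))) := by
  rw [card_eq_sum_card_fiberwise
    (s := univ.filter fun ω : reps π S → Fin (reps π S).card × Bool => cutOf π S c s ω ∈ B)
    (f := fun ω => cutOf π S c s ω) (t := B) (fun ω hω => (mem_filter.1 hω).2)]
  have h : ∀ U ∈ B, ((univ.filter fun ω : reps π S → Fin (reps π S).card × Bool =>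
      cutOf π S c s ω ∈ B).filter fun ω => cutOf π S c s ω = U).card =
        c ^ c * (2 * s) ^ s * (2 * ((reps π S).card - (c + s))) ^ ((reps π S).card - (c + s)) := by
    intro U hUB
    rw [filter_filter]
    have hset : (univ.filter fun ω : reps π S → Fin (reps π S).card × Bool =>
        cutOf π S c s ω ∈ B ∧ cutOf π S c s ω = U) = univ.filter fun ω => cutOf π S c s ω = U := by
      ext ω; simp only [mem_filter, mem_univ, true_and]
      exact ⟨fun h => h.2, fun h => ⟨h ▸ hUB, h⟩⟩
    rw [hset]
    exact card_fibre_eq hπ hπ' hS (hB hUB)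
  rw [sum_congr rfl h, sum_const, smul_eq_mul]

/-- **Hoeffding on the product space for an edge kernel**: for `ε ≥ 0`, kernel values in `[a_e, b_e]` on every edge
and `Σ_e (b_e − a_e)² > 0`,
`#{ω : |Σ_e ψ_e(U(ω) ∩ {e,πe}) − Σ_e E ψ_e| ≥ ε} ≤ 2·exp(−2ε²/Σ_e(b_e − a_e)²)·(2N)^N`.
[cite: Hoeffding1963, Thm. 2; DevroyeGyorfiLugosi1996, Thm. 8.1] -/
theorem card_dev_cfg_kernel_le {S : Finset (Fin n)} {c s : ℕ} (hcs : c + s ≤ (reps π S).card)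
    (ψ : Fin n → Finset (Fin n) → ℝ) (a b : Fin n → ℝ)
    (hab : ∀ e ∈ reps π S, ∀ T, T ⊆ ({e, π e} : Finset (Fin n)) → ψ e T ∈ Set.Icc (a e) (b e))
    {ε : ℝ} (hε : 0 ≤ ε) (hR : 0 < ∑ e ∈ reps π S, (b e - a e) ^ 2) :
    ((univ.filter fun ω : reps π S → Fin (reps π S).card × Bool =>
        ε ≤ |∑ e ∈ reps π S, ψ e (cutOf π S c s ω ∩ {e, π e}) - ∑ e ∈ reps π S, edgeMean π S c s ψ e|).card : ℝ)
      ≤ 2 * Real.exp (-(2 * ε ^ 2 / ∑ e ∈ reps π S, (b e - a e) ^ 2)) *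
        (2 * ((reps π S).card : ℝ)) ^ (reps π S).card := by
  set N := (reps π S).card with hN
  set f : ∀ _e : reps π S, Fin N × Bool → ℝ :=
    fun e lb => ψ e (piece π c s (e : Fin n) lb) - edgeMean π S c s ψ e with hf
  have hNpos : 0 < N := by
    by_contra h0
    have h0' : N = 0 := by omega
    have : reps π S = ∅ := card_eq_zero.1 (hN ▸ h0')
    rw [this, sum_empty] at hR
    exact lt_irrefl _ hR
  have hf0 : ∀ e, ∑ lb, f e lb = 0 := by
    intro e
    simp only [hf]
    rw [sum_sub_distrib, sum_labels_piece_kernel hπ' hcs (e : Fin n) (ψ e), sum_const, card_univ,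
      Fintype.card_prod, Fintype.card_fin, Fintype.card_bool, nsmul_eq_mul, edgeMean, ← hN]
    have hN0 : (N : ℝ) ≠ 0 := by exact_mod_cast hNpos.ne'
    field_simp
    push_cast
    ring
  have hfI : ∀ (e : reps π S) (lb : Fin N × Bool),
      f e lb ∈ Set.Icc (a e - edgeMean π S c s ψ e) (b e - edgeMean π S c s ψ e) := by
    intro e lb
    have h := hab (e : Fin n) e.2 _ (piece_subset_pair c s (e : Fin n) lb)
    simp only [hf, Set.mem_Icc] at h ⊢
    constructor <;> linarith [h.1, h.2]
  have hwidth : ∑ e : reps π S, (b e - edgeMean π S c s ψ e - (a e - edgeMean π S c s ψ e)) ^ 2 =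
      ∑ e ∈ reps π S, (b e - a e) ^ 2 := by
    rw [← sum_coe_sort (reps π S) (f := fun e => (b e - a e) ^ 2)]
    exact sum_congr rfl fun e _ => by ring
  have hRpos : 0 < ∑ e : reps π S, (b e - edgeMean π S c s ψ e - (a e - edgeMean π S c s ψ e)) ^ 2 := by
    rw [hwidth]; exact hR
  have h := Literature.Probability.Moments.hoeffding_count_pi_Icc_abs (κ := fun _ : reps π S => Fin N × Bool) f
    (fun e => a e - edgeMean π S c s ψ e) (fun e => b e - edgeMean π S c s ψ e) hf0 hfI hε hRpos
  rw [hwidth] at h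
  have hprod : ∏ _e : reps π S, (Fintype.card (Fin N × Bool) : ℝ) = (2 * (N : ℝ)) ^ N := by
    rw [prod_const, card_univ, Fintype.card_coe, Fintype.card_prod, Fintype.card_fin,
      Fintype.card_bool, ← hN]
    push_cast; ring
  rw [hprod] at h
  refine le_trans (le_of_eq ?_) h
  congr 2
  ext ω
  simp only [mem_filter, mem_univ, true_and]
  rw [sum_kernel_cutOf hπ c s ω ψ, ← sum_coe_sort (reps π S) (f := fun e => edgeMean π S c s ψ e)]
  simp only [hf, sum_sub_distrib]

/-- **Sub-Gaussian tail of an edge-additive cut statistic on a shell (counting form).** For a fixed-point-free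
involution `π`, a `π`-stable `S` with `N` edges, an edge kernel `ψ` with `ψ_e(T) ∈ [a_e, b_e]` for all
`T ⊆ {e, πe}`, and `ε ≥ 0`:
`#{U ∈ Shell_S(c+2s,c) : |Σ_{e ∈ reps S} ψ_e(U ∩ {e,πe}) − Σ_e edgeMean_e| ≥ ε} ≤ 2(N+1)³·exp(−2ε²/Σ_e(b_e−a_e)²)·#Shell`,
`edgeMean_e = (c(ψ_e{e}+ψ_e{πe}) + 2s·ψ_e{e,πe} + 2(N−c−s)·ψ_e ∅)/(2N)`. Instances: `ψ_e(T) = Σ_{w∈T} φ(w)`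
(§6); `ψ_e(T) = [|T| = 1]·|T ∩ H|` gives `|half(U) ∩ H|`; `ψ_e(T) = [T = {e,πe} ⊆ H]` gives the number of full
`HH` edges — the mixing variables of `shellGen_eq_sum_halfSets_hyperGen`.
[cite: Hoeffding1963, Thm. 2; CoverThomas2005, Thm. 11.1.4; FriezeKaronski2016, §1.1 Lemma 1.2 (PDF pp. 11–12)] -/
theorem card_shellIn_filter_edgeStat_dev_le {S : Finset (Fin n)} (hS : ∀ v ∈ S, π v ∈ S)
    (ψ : Fin n → Finset (Fin n) → ℝ) (a b : Fin n → ℝ)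
    (hab : ∀ e ∈ reps π S, ∀ T, T ⊆ ({e, π e} : Finset (Fin n)) → ψ e T ∈ Set.Icc (a e) (b e))
    (c s : ℕ) {ε : ℝ} (hε : 0 ≤ ε) :
    (((shellIn π S (c + 2 * s) c).filter fun U =>
        ε ≤ |∑ e ∈ reps π S, ψ e (U ∩ {e, π e}) - ∑ e ∈ reps π S, edgeMean π S c s ψ e|).card : ℝ) ≤
      2 * (((reps π S).card : ℝ) + 1) ^ 3 * Real.exp (-(2 * ε ^ 2 / ∑ e ∈ reps π S, (b e - a e) ^ 2)) *
        (shellIn π S (c + 2 * s) c).card := by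
  set N := (reps π S).card with hN
  set μ : ℝ := ∑ e ∈ reps π S, edgeMean π S c s ψ e with hμ
  set R : ℝ := ∑ e ∈ reps π S, (b e - a e) ^ 2 with hRdef
  set Sh := shellIn π S (c + 2 * s) c with hSh
  set A := Sh.filter fun U => ε ≤ |∑ e ∈ reps π S, ψ e (U ∩ {e, π e}) - μ| with hA
  have hA_le : (A.card : ℝ) ≤ Sh.card := by exact_mod_cast card_le_card (filter_subset _ _)
  have hpoly : (1 : ℝ) ≤ 2 * ((N : ℝ) + 1) ^ 3 := by
    have : (1 : ℝ) ≤ ((N : ℝ) + 1) ^ 3 := one_le_pow₀ (by linarith [(Nat.cast_nonneg N : (0:ℝ) ≤ N)])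
    linarith
  by_cases hR : R = 0
  · rw [hR, div_zero, neg_zero, Real.exp_zero, mul_one]
    calc (A.card : ℝ) ≤ Sh.card := hA_le
      _ = 1 * Sh.card := (one_mul _).symm
      _ ≤ 2 * ((N : ℝ) + 1) ^ 3 * Sh.card := mul_le_mul_of_nonneg_right hpoly (Nat.cast_nonneg _)
  have hRpos : 0 < R := lt_of_le_of_ne (sum_nonneg fun e _ => sq_nonneg _) (Ne.symm hR)
  by_cases hne : Sh.Nonempty
  swap
  · rw [not_nonempty_iff_eq_empty] at hne
    have hA0 : A = ∅ := by rw [hA, hne, filter_empty]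
    rw [hA0, hne, card_empty]; simp
  obtain ⟨U₀, hU₀⟩ := hne
  have hcs : c + s ≤ N := (localType_counts hπ hπ' hS hU₀).2.2.2
  set K : ℕ := c ^ c * (2 * s) ^ s * (2 * (N - (c + s))) ^ (N - (c + s)) with hK
  have hKpos : (0 : ℝ) < K := by
    have hpow : ∀ a b : ℕ, (a = 0 → b = 0) → 0 < a ^ b := fun a b h => by
      rcases Nat.eq_zero_or_pos a with ha | ha
      · rw [ha, h ha, pow_zero]; exact Nat.one_pos
      · exact pow_pos ha b
    have hK0 : 0 < K :=
      Nat.mul_pos (Nat.mul_pos (hpow c c id) (hpow _ _ (by omega))) (hpow _ _ (by omega))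
    exact_mod_cast hK0
  have hfibA : ((univ.filter fun ω : reps π S → Fin N × Bool => cutOf π S c s ω ∈ A).card : ℝ) = A.card * K := by
    have h := card_filter_cutOf_mem_eq hπ hπ' hS (c := c) (s := s) (B := A) (filter_subset _ _)
    rw [hK]; exact_mod_cast h
  have hfibSh : ((univ.filter fun ω : reps π S → Fin N × Bool => cutOf π S c s ω ∈ Sh).card : ℝ) =
      Sh.card * K := by
    have h := card_filter_cutOf_mem_eq hπ hπ' hS (c := c) (s := s) (B := Sh) Subset.rfl
    rw [hK]; exact_mod_cast h
  have hdev : ((univ.filter fun ω : reps π S → Fin N × Bool => cutOf π S c s ω ∈ A).card : ℝ) ≤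
      2 * Real.exp (-(2 * ε ^ 2 / R)) * (2 * (N : ℝ)) ^ N := by
    refine le_trans ?_ (card_dev_cfg_kernel_le hπ hπ' hcs ψ a b hab hε hRpos)
    exact_mod_cast card_le_card fun ω hω => by
      simp only [mem_filter, mem_univ, true_and, hA] at hω ⊢
      exact hω.2
  have hlow : (2 * (N : ℝ)) ^ N ≤ ((N : ℝ) + 1) ^ 3 * (Sh.card * K) := by
    rw [← hfibSh]
    exact typeCfg_lower hπ hπ' hS hcs
  have hAK : (A.card : ℝ) * K ≤ (2 * ((N : ℝ) + 1) ^ 3 * Real.exp (-(2 * ε ^ 2 / R)) * Sh.card) * K := by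
    rw [← hfibA]
    calc _ ≤ 2 * Real.exp (-(2 * ε ^ 2 / R)) * (2 * (N : ℝ)) ^ N := hdev
      _ ≤ 2 * Real.exp (-(2 * ε ^ 2 / R)) * (((N : ℝ) + 1) ^ 3 * (Sh.card * K)) :=
          mul_le_mul_of_nonneg_left hlow (by positivity)
      _ = (2 * ((N : ℝ) + 1) ^ 3 * Real.exp (-(2 * ε ^ 2 / R)) * Sh.card) * K := by ring
  exact le_of_mul_le_mul_right hAK hKpos

/-- The half-set statistic is edge-additive: `|half(U) ∩ H| = Σ_e [|U ∩ {e,πe}| = 1]·|U ∩ {e,πe} ∩ H|` for `U ⊆ S`.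
[cite: Rothvoss2017, §2 (PDF p. 5)] -/
theorem card_half_inter_eq_sum_kernel {S : Finset (Fin n)} (hS : ∀ v ∈ S, π v ∈ S) (H : Finset (Fin n))
    {U : Finset (Fin n)} (hU : U ⊆ S) :
    ((half π U ∩ H).card : ℝ) =
      ∑ e ∈ reps π S, (if (U ∩ {e, π e}).card = 1 then (((U ∩ {e, π e}) ∩ H).card : ℝ) else 0) := by
  rw [card_eq_sum_card_inter_pair hπ hπ' hS ((inter_subset_left.trans (half_subset U)).trans hU)]
  push_cast
  refine sum_congr rfl fun e _ => ?_
  have hset : half π U ∩ H ∩ {e, π e} = (half π U ∩ {e, π e}) ∩ H := by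
    ext w; simp only [mem_inter]; tauto
  rw [hset]
  by_cases h1 : (U ∩ {e, π e}).card = 1
  · rw [if_pos h1]
    -- when the edge is met once, `half(U) ∩ {e,πe} = U ∩ {e,πe}`
    have hsub : half π U ∩ {e, π e} ⊆ U ∩ {e, π e} :=
      inter_subset_inter (half_subset U) Subset.rfl
    have hcard : (half π U ∩ {e, π e}).card = (U ∩ {e, π e}).card := by
      rw [card_half_inter_pair hπ hπ' U e, if_pos h1, h1]
    rw [eq_of_subset_of_card_le hsub hcard.ge]
  · rw [if_neg h1]
    have h0 : half π U ∩ {e, π e} = ∅ := by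
      rw [← card_eq_zero, card_half_inter_pair hπ hπ' U e, if_neg h1]
    rw [h0, empty_inter, card_empty, Nat.cast_zero]

omit hπ hπ' in
/-- The number of full `HH` edges is edge-additive: `#{e ∈ reps S : e, πe ∈ H, {e,πe} ⊆ U} = Σ_e [U ∩ {e,πe} = {e,πe}]·[e ∈ H]·[πe ∈ H]`.
[cite: Rothvoss2017, §2 (PDF p. 5)] -/
theorem card_fullHH_eq_sum_kernel {S : Finset (Fin n)} (H U : Finset (Fin n)) :
    ((((reps π S).filter fun e => e ∈ H ∧ π e ∈ H ∧ e ∈ U ∧ π e ∈ U).card : ℕ) : ℝ) =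
      ∑ e ∈ reps π S, (if U ∩ {e, π e} = {e, π e} ∧ e ∈ H ∧ π e ∈ H then (1 : ℝ) else 0) := by
  rw [← sum_boole]
  refine sum_congr rfl fun e _ => ?_
  have hiff : (e ∈ H ∧ π e ∈ H ∧ e ∈ U ∧ π e ∈ U) ↔ (U ∩ {e, π e} = {e, π e} ∧ e ∈ H ∧ π e ∈ H) := by
    constructor
    · rintro ⟨h1, h2, h3, h4⟩
      exact ⟨inter_eq_right.2 (insert_subset h3 (singleton_subset_iff.2 h4)), h1, h2⟩
    · rintro ⟨h, h1, h2⟩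
      have h' : ({e, π e} : Finset (Fin n)) ⊆ U := inter_eq_right.1 h
      exact ⟨h1, h2, h' (mem_insert_self _ _), h' (mem_insert_of_mem (mem_singleton_self _))⟩
  simp only [hiff]

end Tail

end ShellStep

end Literature.Combinatorics.Optimization
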